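import Literature.Barriers.ValiantsHypothesis.CT23ExplicitMatrixSquaring
import Literature.Computability.AlgebraicComplexity.BooleanGadgetPolynomials
import Literature.Computability.AlgebraicComplexity.IL17LayeredDetProgram
import Literature.Computability.AlgebraicComplexity.RealTauConjectureDepthFour
import HarnessLib

/-!
# The determinant as the `(s, t)` entry of a power of an EXPLICITLY ENCODED matrix:
# Mahajan–Vinay's branching program with an explicit adjacency-matrix encoder
# (Chatterjee–Tengse arXiv:2309.07612, proof of Prop. "Computing determinant of explicit matrices",
# first Claim = v1 Claim 37; val-lit t24 g9, X-CT23 engine brick E-d)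

Theorem-only (plus plumbing `def`s) companion of `CT23LowerBoundsFromSuccinctHittingSets.lean`,
`CT23ProjCircuitSubstitution.lean` (brick E-a), `CT23ExplicitMatrixSquaring.lean` (brick E-c) and
`Literature/Computability/AlgebraicComplexity/BooleanGadgetPolynomials.lean` (brick E-b); NO named
facts. Honest framing: this is the "explicit ABP for the determinant" half of the source's
"determinant of an explicit matrix in `VPSPACE`" engine (v1 Prop. 36 = Claims 37 + 38; held text
`paper:arxiv-2309.07612` p0012.txt:L17–L79, p0013.txt:L1–L8); it discharges nothing by itself;
`VP ≠ VNP` is NOT proved and nothing here bears on it.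

## The printed claim (v1 Claim 37, p0012.txt:L30–L67, and the padding remark p0013.txt:L1–L8)

"There is an explicit ABP, say `A(x)`, encoded by a circuit of size `O(size(C), N)` that computes
`det(M)`. … The ABP has `N+1` layers of vertices and, except for the first and the last layer,
each layer has `O(N²)` vertices. Vertices of the ABP are labelled by `(ℓ,(i,j))` … [edges
`(ℓ,(i,j)) → (ℓ+1,(i,k))`, `k > i`, label `M[j,k]`; `→ (ℓ+1,(k,k))`, `k > i`, label `−M[j,i]`;
`(N,(i,j)) → sink`, label `−M[j,i]`] … Each vertex of the ABP is a vector of `3 log N` bits …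
`Ĉ(x,u,v) = valid(u)·valid(v)·G(x,u,v)` [with `G` a sum of products of the gadgets `EQ, GT, INC`
of Obs. 2.9 and copies `C(x, j_u, j_v)`, `C(x, i_u, j_u)` of the encoder] … The correctness of this
expression is easy to check using the description of the ABP. Also, `Ĉ` has size
`O(size(C) + log² N)` and is a constant-free algebraic circuit (without projection gates) if `C`
is constant free." And (Claim 38): "The polynomial computed by the ABP is just the `(s,t)`-th
entry of the matrix `A^N` … we modify the ABP by adding layers … to ensure that `N'` is a power of
`2` … the `(s,t)`-th entry of `A^{N'}` is the same as the `(s,t)`-th entry of `A^N`."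

## Rendering (what is proved, and the two deliberate deviations)

* The matrix: `M = matOf r c E`, the `2^L × 2^L` matrix encoded (Def. 2.27, brick E-c's `matOf`)
  by a polynomial `E ∈ k[τ]` with row/column index blocks `r c : Fin L → τ`; so `N = 2^L` IS a
  power of two and no extra layers are needed.
* The ABP: the source prints Mahajan–Vinay's program with heads = least vertex and cites [S15]
  for its correctness. We use THE TREE'S signed Mahajan–Vinay program in Berkowitz orientation
  (`GKKP2011.T₀ / start₀`, layered as `IL17.fullN / fullSrc / fullSnk`, whose value `= det` is
  PROVED there: `IL17.fullSrc_vecMul_pow`, `IL17.layerVec_svVec_dotProduct_fullSnk`,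
  `GKKP2011.sv_spec`): vertices = source, the `(n+1)·(n+2)²` layer states
  `(layer, (head, current vertex))` (`N = n + 2`; exactly the printed vertex set `(ℓ,(i,j))`,
  unpruned), sink; one square adjacency matrix `mvAdjGen` (generic `X_{ij}`) / `mvAdj M`, with the
  internal layers carrying MINUS the transfer weights (Mahajan–Vinay's global sign) and — the
  second deviation — a unit SELF-LOOP at the sink instead of the printed chain of unit edges, so
  that **`(A^P)_{s,t} = det` for EVERY `P ≥ N`** (`mvAdjGen_pow_src_snk`, `mvAdj_pow_src_snk`).
* Labels: one block of `3·L` bits per vertex, sub-blocks `part 0/1/2` = (layer, head, current)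
  via `finProdFinEquiv`; layer states have layer block `≤ n`, the source is `(1…1, 0…0, 0…0)`
  (`srcLab`), the sink `(1…1, 1…1, 1…1)` (`snkLab`); other labels are non-vertices (`decLab`/`encLab`,
  zero rows and columns: `padded`, `padded_pow_enc`).
* The encoder `Ĉ` = `mvEdge r c E U V` (label blocks `U V : Fin (3L) → τ`): the template
  `mvEdgeT` — sink loop `+` source edges `−` internal transitions `+` last-layer-to-sink
  transitions, written with `EQ / LT / INC` of brick E-b — at TWO renamed copies
  `C(x, u_u, u_v)`, `C(x, t_v, u_v)` of `E` (`copyPoly`; the printed `G` uses three).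
  **`matOf_mvEdge_apply`** computes its value at any pair of labels, **`numEdge_eq_padded`**
  identifies it with the padded adjacency matrix, and the MAIN IDENTITY
  **`matOf_mvEdge_pow_apply_src_snk`**: for `P ≥ 2^L`,
  `((matOf U V (mvEdge r c E U V)) ^ P) (srcLab L) (snkLab L) = (matOf r c E).det`
  — with brick E-c′'s `matOf_powPoly` at `j = L` this is the source's `C'(x) = D_k(x, s, t)`.
* The circuit (`exists_projCircuit_mvEdge_general`): from a fan-in-two `ProjCircuit` `C` (ANY
  constants) computing `E` and projecting none of `r, c, U, V`, a fan-in-two `ProjCircuit`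
  computing `mvEdge r c E U V` of size `≤ 2·C.size + (112·L² + 253·L + 49)` ("`O(size(C) +
  log² N)`"), projecting only what `C` projects, and — the printed "moreover" — constant-free
  whenever `C` is (`C.HasSignConstants → Q.HasSignConstants`; `exists_projCircuit_mvEdge` is the
  constant-free corollary, the first accepted statement); built as copy, copy, then a gadget
  TEMPLATE circuit (a `HasTauDeg` witness over `ℤ` mapped to `k`, `hasTauDeg_mvEdgeT`) spliced
  onto the two outputs by brick E-a's `ProjCircuit.subst` (two scratch variable names `μ₁ ≠ μ₂`
  outside the label blocks mark the splice points). `notMem_vars_mvEdge`: `Ĉ` mentions only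
  `E.vars`, `U`, `V` (fresh workspace for the squaring recursion can avoid it). ERRATUM (t24 g10,
  referee rows np 1357 / 1370): the first accepted text had only the constant-free case, with
  `C.HasSignConstants` a HYPOTHESIS where the source prints an implication; the general theorem
  is the correction (same construction).
* Numbering: the held text is v1 (sequential numbering: Obs. 17, Def. 34, Prop. 36, Claims 37/38);
  cites below name the v1 Claim with the file locator; in v2 this is the first Claim in the proof
  of the Proposition "Computing determinant of explicit matrices" of §2.4 (the cell concordance
  `PROOF-SOURCES §6.11` numbers it Prop. 2.29 / Claim 2.30, the form `Claim 2.30 (v1: Claim 37;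
  p0012.txt:L30–L70)` used by the two circuit theorems below; the companion engine files write
  "Prop. 2.28 / Claim 38").

## Main declarations (namespace `Literature.Barriers.ValiantsHypothesis`)

* Part A/B: `MVState`, `mvAdjGen`, `srcRow`, `mvAdjGen_pow_src`, **`mvAdjGen_pow_src_snk`**,
  `mvSpec`, `mvAdj`, **`mvAdj_pow_src_snk`**, `entryN`, `selW`, `transN`, `mvAdj_src_mid`,
  `mvAdj_mid_mid`, `mvAdj_mid_snk`, `mvAdj_snk_snk`, `mvAdj_apply_src`, `mvAdj_snk_mid`.
* Part C/D: `padded`, `padded_pow_enc`; `part`, `glue`, `bitsFin`, `bitsEquiv`, `reidx`,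
  `det_reidx`, `entryN_reidx`, `decLab`, `encLab`, `srcLab`, `snkLab`, `decLab_encLab`, `eq_encLab_of_decLab`.
* Part E: `Xp`, `kbits`, `copyPoly`, `selP`, `transT`, `isSrcP`, `isSnkP`, `isSuccP`, `isLastP`,
  `mvEdgeT`, **`mvEdge`**, `MVFresh`, `labSubst_copyPoly`, `numTrans`, `numEdge`,
  **`matOf_mvEdge_apply`**, `selW_eq`, `numTrans_eq_transN`, **`numEdge_eq_padded`**,
  `notMem_vars_EQ/LT/INC/copyPoly`, **`notMem_vars_mvEdge`**, **`matOf_mvEdge_pow_apply_src_snk`**.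
* Part F: `map_mvEdgeT`, **`hasTauDeg_mvEdgeT`**, `copyOps`, `copySubst`, `substCompat_copySubst`,
  `gateValues_subst`, `projVars_subst_subset`, `projVars_ofArithCircuit`, `copy1`, `copy2`,
  `tmplOps`, `mvCircuit`, `eval_copy1`, `eval_copy2`, **`exists_projCircuit_mvEdge_general`**
  (any constants, with the constant-free "moreover"), `exists_projCircuit_mvEdge` (constant-free
  corollary).

## References

* [ChatterjeeTengse2023] P. Chatterjee, A. Tengse, *Lower Bounds from Succinct Hitting Sets*,
  arXiv:2309.07612 (v1: Obs. 17, Def. 34–35, Prop. 36, Claims 37–38; held text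
  p0011.txt:L82, p0012.txt:L17–L79, p0013.txt:L1–L25).
* [MahajanVinay1997] M. Mahajan, V. Vinay, *Determinant: combinatorics, algorithms, and
  complexity*, Chicago J. Theoret. Comput. Sci. 1997, §3, Thm. 1 (the signed clow program; the
  tree's `GKKP2011.sv`, `T₀`).
* [MahajanVinay1999] M. Mahajan, V. Vinay, *Determinant: Old Algorithms, New Insights*, SIAM J.
  Discrete Math. 12 (1999) 474–490, Def. 3.1 (clow sequences; held text
  `paper:doi-10-1137-s0895480198338827` p0004.txt:L42–L52) and Thm. 3.2 (= [MahajanVinay1997,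
  Thm. 1]; p0005.txt:L20), with the layered clow program p0006.txt:L11–L47 (the state space
  `(ℓ, (head, current))` of CT23's Claim 2.30).
* [IkenmeyerLandsberg2017] C. Ikenmeyer, J. M. Landsberg, *On the complexity of the permanent in
  various computational models*, JPAA 221 (2017), Prop. 3.2 (the layered program `IL17.fullN`).
* [Burgisser2000] P. Bürgisser, *Completeness and Reduction in Algebraic Complexity Theory*,
  Springer 2000, §4.1 (change of coefficients), for the `ℤ → k` transfer of the gadget circuit.
-/

noncomputable section

open MvPolynomial

namespace Literature.Barriers.ValiantsHypothesis

open Literature.Computability.AlgebraicComplexity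
open _root_.Matrix Finset Berkowitz GKKP2011 IL17

universe u v

/-! ## Part A. The signed Mahajan–Vinay program as ONE square matrix; its powers give `det` -/

section Program

variable (k : Type u) [CommRing k] (n : ℕ)

/-- The vertices of the program for `(n+2) × (n+2)` matrices: the source, the layered states
`(i, (t, u))` (`i ≤ n` the layer = number of internal edges so far, `t` the head and `u` the
current vertex of the open clow; `IL17.LState n`), and the sink.
[cite: ChatterjeeTengse2023, Claim 37 (v1; p0012.txt:L36–L40)] -/
abbrev MVState : Type := Unit ⊕ LState n ⊕ Unit

/-- The source vertex. [cite: ChatterjeeTengse2023, Claim 37 (v1; p0012.txt:L36–L40)] -/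
abbrev MVState.src : MVState n := Sum.inl ()
/-- An internal vertex `(layer, (head, current))`. [cite: ChatterjeeTengse2023, Claim 37 (v1; p0012.txt:L36–L40)] -/
abbrev MVState.mid (p : LState n) : MVState n := Sum.inr (Sum.inl p)
/-- The sink vertex. [cite: ChatterjeeTengse2023, Claim 37 (v1; p0012.txt:L36–L40)] -/
abbrev MVState.snk : MVState n := Sum.inr (Sum.inr ())

open MVState

/-- **The adjacency matrix of the signed Mahajan–Vinay program** for the GENERIC matrix
`(X_{ij})_{i,j < n+2}` (Berkowitz orientation, the tree's `GKKP2011.T₀` / `IL17.fullN`): source →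
layer `0` by the source weights `fullSrc` (first edge of the first clow), layer `i` → layer
`i + 1` by MINUS the transfer matrix (continue the clow `X_{uv}` / close it `−X_{ut}` / open the
next one; the global sign `(-1)^{n}` of the `n` internal layers is Mahajan–Vinay's
`sgn = (-1)^{N + #clows}` bookkeeping), last layer → sink by `fullSnk`, and a unit self-loop at the
sink (padding: every source–sink walk of length `≥ n + 2` is a source–sink path followed by loops).
[cite: ChatterjeeTengse2023, Claim 37 (v1; p0012.txt:L36–L47, p0013.txt:L1–L8)] -/
def mvAdjGen : Matrix (MVState n) (MVState n) (MvPolynomial (Fin (n + 2) × Fin (n + 2)) k) :=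
  Matrix.of fun x y =>
    match x, y with
    | Sum.inl _, Sum.inr (Sum.inl q) => fullSrc k n q
    | Sum.inr (Sum.inl p), Sum.inr (Sum.inl q) => -fullN k n p q
    | Sum.inr (Sum.inl p), Sum.inr (Sum.inr _) => fullSnk k n p
    | Sum.inr (Sum.inr _), Sum.inr (Sum.inr _) => 1
    | _, _ => 0

/-- The source row of the `m`-th power, in closed form: nothing returns to the source, layer
states carry `fullSrc · (−fullN)^{m−1}`, and the sink accumulates all shorter source–sink path
weights. [cite: ChatterjeeTengse2023, Claim 38 "the (s,t)-th entry of the matrix A^N" (v1; p0012.txt:L77–L79)] -/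
def srcRow (m : ℕ) : MVState n → MvPolynomial (Fin (n + 2) × Fin (n + 2)) k
  | Sum.inl _ => if m = 0 then 1 else 0
  | Sum.inr (Sum.inl q) => if m = 0 then 0 else (fullSrc k n ᵥ* (-fullN k n) ^ (m - 1)) q
  | Sum.inr (Sum.inr _) => ∑ j ∈ range (m - 1), fullSrc k n ᵥ* (-fullN k n) ^ j ⬝ᵥ fullSnk k n

variable {k n}

/-- Entries of `mvAdjGen` (definitional unfoldings). [folklore] -/
private theorem mvAdjGen_apply (x y : MVState n) :
    mvAdjGen k n x y = match x, y with
    | Sum.inl _, Sum.inr (Sum.inl q) => fullSrc k n q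
    | Sum.inr (Sum.inl p), Sum.inr (Sum.inl q) => -fullN k n p q
    | Sum.inr (Sum.inl p), Sum.inr (Sum.inr _) => fullSnk k n p
    | Sum.inr (Sum.inr _), Sum.inr (Sum.inr _) => 1
    | _, _ => 0 := rfl

/-- **The source row of `A^m`.** [cite: ChatterjeeTengse2023, Claim 38 (v1; p0012.txt:L77–L79)] -/
theorem mvAdjGen_pow_src (m : ℕ) (y : MVState n) :
    (mvAdjGen k n ^ m) (src n) y = srcRow k n m y := by
  induction m generalizing y with
  | zero =>
    rcases y with ⟨⟨⟩⟩ | ⟨q | ⟨⟨⟩⟩⟩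
    · simp [srcRow]
    · simp [srcRow]
    · simp [srcRow]
  | succ m ih =>
    rw [pow_succ, Matrix.mul_apply]
    simp_rw [ih]
    rw [Fintype.sum_sum_type, Fintype.sum_sum_type]
    simp only [Finset.univ_unique, Finset.sum_singleton]
    have h0 : ∀ x : MVState n, mvAdjGen k n x (Sum.inl PUnit.unit) = 0 := by
      rintro (⟨⟨⟩⟩ | ⟨p | ⟨⟨⟩⟩⟩) <;> rfl
    have h3 : ∀ q : LState n,
        mvAdjGen k n (Sum.inr (Sum.inr PUnit.unit)) (Sum.inr (Sum.inl q)) = 0 := fun q => rfl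
    have h2 : ∀ p q : LState n,
        mvAdjGen k n (Sum.inr (Sum.inl p)) (Sum.inr (Sum.inl q)) = -fullN k n p q := fun p q => rfl
    have h1 : ∀ q : LState n,
        mvAdjGen k n (Sum.inl PUnit.unit) (Sum.inr (Sum.inl q)) = fullSrc k n q := fun q => rfl
    have h4 : mvAdjGen k n (Sum.inl PUnit.unit) (Sum.inr (Sum.inr PUnit.unit)) = 0 := rfl
    have h5 : ∀ p : LState n,
        mvAdjGen k n (Sum.inr (Sum.inl p)) (Sum.inr (Sum.inr PUnit.unit)) = fullSnk k n p := fun p => rfl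
    have h6 : mvAdjGen k n (Sum.inr (Sum.inr PUnit.unit)) (Sum.inr (Sum.inr PUnit.unit)) = 1 := rfl
    rcases y with ⟨⟨⟩⟩ | ⟨q | ⟨⟨⟩⟩⟩
    · -- into the source: no edges
      simp [h0, srcRow]
    · -- into a layer state
      simp only [h1, h2, h3, mul_zero, add_zero, srcRow]
      obtain _ | m := m
      · simp
      · simp only [Nat.succ_ne_zero, ↓reduceIte, zero_mul, zero_add, Nat.add_sub_cancel, pow_succ,
          ← Matrix.vecMul_vecMul]
        rfl
    · -- into the sink
      simp only [h4, h5, h6, mul_zero, zero_add, mul_one, srcRow]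
      obtain _ | m := m
      · simp
      · simp only [Nat.succ_ne_zero, ↓reduceIte, Nat.add_sub_cancel, Finset.sum_range_succ]
        exact add_comm _ _

/-- The value of the unpruned program: only the path length `n` internal edges reaches the sink,
with Mahajan–Vinay's value `sv (n+2) (n+1) (n+1)` there. [cite: IkenmeyerLandsberg2017, Prop. 3.2 (proof)] -/
private theorem fullSrc_negPow_dotProduct_fullSnk (j : ℕ) :
    fullSrc k n ᵥ* (-fullN k n) ^ j ⬝ᵥ fullSnk k n =
      if j = n then (-1) ^ n * sv k (n + 2) (n + 2) (n + 1) (n + 1) else 0 := by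
  rw [← neg_one_smul (MvPolynomial (Fin (n + 2) × Fin (n + 2)) k) (fullN k n), smul_pow,
    Matrix.vecMul_smul, smul_dotProduct, smul_eq_mul, fullSrc_vecMul_pow]
  change (-1) ^ j * ∑ p : LState n, layerVec k n j (svVec k n (j + 1)) p * fullSnk k n p = _
  rw [layerVec_svVec_dotProduct_fullSnk]
  by_cases hj : j = n
  · rw [if_pos hj, if_pos hj, hj]
  · rw [if_neg hj, if_neg hj, mul_zero]

/-- **`(A^P)_{s,t} = det X` for every `P ≥ n + 2`** (generic matrix): the `(source, sink)` entry
of a high enough power of the program's adjacency matrix is the determinant.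
[cite: ChatterjeeTengse2023, Claims 37–38 (v1; p0012.txt:L30–L34, p0012.txt:L77–L79, p0013.txt:L6–L7)] -/
theorem mvAdjGen_pow_src_snk (P : ℕ) (hP : n + 2 ≤ P) :
    (mvAdjGen k n ^ P) (src n) (snk n) = detPoly (Fin (n + 2)) k := by
  rw [mvAdjGen_pow_src]
  simp only [srcRow]
  simp_rw [fullSrc_negPow_dotProduct_fullSnk]
  rw [Finset.sum_ite_eq', if_pos (Finset.mem_range.2 (by omega))]
  have hsv : sv k (n + 2) (n + 2) (n + 1) (n + 1) = (chi k (n + 2) (n + 2)).coeff 0 := by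
    rw [(sv_spec (k := k) (n := n + 2) (n + 2)).2.1 (n + 1), e_of_lt (show n + 1 < n + 2 by omega),
      sub_zero]
    unfold GKKP2011.e
    rw [if_pos le_rfl, Nat.sub_self]
  rw [hsv, detPoly, ← genBlock_self, Matrix.det_eq_sign_charpoly_coeff, Fintype.card_fin, pow_add,
    neg_one_sq, mul_one]
  rfl

end Program

/-! ## Part B. Specialising the generic program to an arbitrary matrix -/

section Specialise

variable {R : Type u} [CommRing R] {n : ℕ}

open MVState

/-- Evaluation of the generic entries `X_{ij}` at the matrix `M`. [cite: ChatterjeeTengse2023, Claim 37 (v1; p0012.txt:L36–L47)] -/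
def mvSpec (M : Matrix (Fin (n + 2)) (Fin (n + 2)) R) : MvPolynomial (Fin (n + 2) × Fin (n + 2)) R →+* R :=
  MvPolynomial.eval fun p => M p.1 p.2

/-- **The adjacency matrix of the signed Mahajan–Vinay program for the matrix `M`.**
[cite: ChatterjeeTengse2023, Claim 37 (v1; p0012.txt:L36–L47)] -/
def mvAdj (M : Matrix (Fin (n + 2)) (Fin (n + 2)) R) : Matrix (MVState n) (MVState n) R :=
  (mvAdjGen R n).map (mvSpec M)

/-- **`(A^P)_{s,t} = det M`** for the program of `M` and every `P ≥ n + 2`.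
[cite: ChatterjeeTengse2023, Claims 37–38 (v1; p0012.txt:L30–L34, p0012.txt:L77–L79)] -/
theorem mvAdj_pow_src_snk (M : Matrix (Fin (n + 2)) (Fin (n + 2)) R) {P : ℕ} (hP : n + 2 ≤ P) :
    (mvAdj M ^ P) (src n) (snk n) = M.det := by
  rw [mvAdj, ← Matrix.map_pow, Matrix.map_apply, mvAdjGen_pow_src_snk P hP, detPoly, RingHom.map_det,
    mvSpec, Matrix.mvPolynomialX_mapMatrix_eval]

/-! ### The entries of the specialised program in closed form -/

/-- The entry `M[a, b]` for natural indices (`0` out of range; the specialisation of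
`Berkowitz.xvar`). [cite: ChatterjeeTengse2023, Def. 2.27 "C(x, i, j) = M[i,j]" (v1: Def. 34)] -/
def entryN (M : Matrix (Fin (n + 2)) (Fin (n + 2)) R) (a b : ℕ) : R :=
  if h : a < n + 2 ∧ b < n + 2 then M ⟨a, h.1⟩ ⟨b, h.2⟩ else 0

/-- The sign of an edge INTO the state `(t', u')`: `+1` to continue the clow (`u' < t'`), `−1` to
close it at its head (`u' = t'`), no edge otherwise (Mahajan–Vinay's sign bookkeeping).
[cite: MahajanVinay1997, §3] -/
def selW (t' u' : ℕ) : R := if u' < t' then 1 else if u' = t' then -1 else 0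

/-- One transition of the transfer matrix `T₀` at the matrix `M`, on natural indices: from
`(t, u)` inside a clow (`u < t`) keep the head and move to `u'` with weight `± M[u, u']`; from a
closed head (`u = t`) open a clow with a larger head `t'` and traverse its first edge, weight
`± M[t', u']`. [cite: MahajanVinay1997, §3] -/
def transN (M : Matrix (Fin (n + 2)) (Fin (n + 2)) R) (t u t' u' : ℕ) : R :=
  if u < t then (if t' = t then selW t' u' * entryN M u u' else 0)
  else if u = t then (if t < t' then selW t' u' * entryN M t' u' else 0) else 0

variable (M : Matrix (Fin (n + 2)) (Fin (n + 2)) R)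

/-- Specialising a generic entry. [folklore] -/
private theorem mvSpec_xvar (a b : ℕ) : mvSpec M (xvar R (n + 2) a b) = entryN M a b := by
  unfold xvar entryN
  split_ifs with h
  · simp [mvSpec]
  · simp

/-- Specialising one edge weight: `stepW f t' u' ↦ selW t' u' · M[f, u']` (at `u' = t'` the closing
weight `−M[f, t']` is `−M[f, u']`). [cite: MahajanVinay1997, §3] -/
theorem mvSpec_stepW (f t' u' : ℕ) :
    mvSpec M (stepW R (n + 2) f t' u') = selW t' u' * entryN M f u' := by
  unfold stepW selW
  split_ifs with h1 h2
  · rw [mvSpec_xvar, one_mul]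
  · rw [map_neg, mvSpec_xvar, h2, neg_one_mul]
  · rw [map_zero, zero_mul]

/-- Specialising the transfer matrix. [cite: MahajanVinay1997, §3] -/
theorem mvSpec_T₀ (σ σ' : Fin (n + 2) × Fin (n + 2)) :
    mvSpec M (T₀ R (n + 2) σ σ') = transN M σ.1 σ.2 σ'.1 σ'.2 := by
  simp only [T₀, Matrix.of_apply, transN, Fin.ext_iff]
  split_ifs <;> first | rw [mvSpec_stepW] | rw [map_zero]

/-- Source edges: into layer `0`, opening the first clow. [cite: ChatterjeeTengse2023, Claim 37 (v1; p0012.txt:L41–L47)] -/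
theorem mvAdj_src_mid (q : LState n) :
    mvAdj M (src n) (mid n q) =
      if (q.1 : ℕ) = 0 then selW (q.2.1 : ℕ) q.2.2 * entryN M q.2.1 q.2.2 else 0 := by
  simp only [mvAdj, Matrix.map_apply, mvAdjGen, Matrix.of_apply, fullSrc, start₀]
  split_ifs
  · exact mvSpec_stepW M _ _ _
  · exact map_zero _

/-- Internal edges: one layer down, MINUS the transfer weight. [cite: ChatterjeeTengse2023, Claim 37 (v1; p0012.txt:L41–L47)] -/
theorem mvAdj_mid_mid (p q : LState n) :
    mvAdj M (mid n p) (mid n q) =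
      -(if (q.1 : ℕ) = p.1 + 1 then transN M p.2.1 p.2.2 q.2.1 q.2.2 else 0) := by
  simp only [mvAdj, Matrix.map_apply, mvAdjGen, Matrix.of_apply, fullN, map_neg]
  split_ifs
  · rw [mvSpec_T₀]
  · rw [map_zero]

/-- Sink edges: from the last layer into the state `(n+1, n+1)`. [cite: ChatterjeeTengse2023, Claim 37 (v1; p0012.txt:L41–L47)] -/
theorem mvAdj_mid_snk (p : LState n) :
    mvAdj M (mid n p) (snk n) =
      if (p.1 : ℕ) = n then transN M p.2.1 p.2.2 (n + 1) (n + 1) else 0 := by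
  simp only [mvAdj, Matrix.map_apply, mvAdjGen, Matrix.of_apply, fullSnk]
  split_ifs
  · rw [mvSpec_T₀]; simp
  · rw [map_zero]

/-- The sink's unit self-loop. [cite: ChatterjeeTengse2023, Claim 38 (v1; p0013.txt:L1–L6)] -/
theorem mvAdj_snk_snk : mvAdj M (snk n) (snk n) = 1 := by
  simp [mvAdj, mvAdjGen]

/-- Nothing enters the source. [cite: ChatterjeeTengse2023, Claim 37 (v1; p0012.txt:L41–L47)] -/
theorem mvAdj_apply_src (x : MVState n) : mvAdj M x (src n) = 0 := by
  rcases x with ⟨⟨⟩⟩ | ⟨p | ⟨⟨⟩⟩⟩ <;> simp [mvAdj, mvAdjGen]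

/-- The sink only loops. [cite: ChatterjeeTengse2023, Claim 38 (v1; p0013.txt:L1–L6)] -/
theorem mvAdj_snk_mid (q : LState n) : mvAdj M (snk n) (mid n q) = 0 := by
  simp [mvAdj, mvAdjGen]

/-- No edge from the source straight to the sink. [cite: ChatterjeeTengse2023, Claim 37 (v1; p0012.txt:L41–L47)] -/
theorem mvAdj_src_snk : mvAdj M (src n) (snk n) = 0 := by
  simp [mvAdj, mvAdjGen]

end Specialise

/-! ## Part C. Zero-padding a matrix to a larger index set does not change its powers -/

section Padding

variable {R : Type u} [CommRing R] {Λ : Type*} {V : Type*} [Fintype Λ] [Fintype V]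
  [DecidableEq Λ] [DecidableEq V]

/-- The zero-padded copy of `A` along a partial decoding `decLab : Λ → Option V` of labels into
vertices ("`valid` … ensure[s] that `Ĉ` outputs `0` whenever it is given a pair of labels that is
of a non-edge"). [cite: ChatterjeeTengse2023, Claim 37 (v1; p0012.txt:L63)] -/
def padded (A : Matrix V V R) (decLab : Λ → Option V) : Matrix Λ Λ R :=
  Matrix.of fun x y =>
    match decLab x, decLab y with
    | some p, some q => A p q
    | _, _ => 0

omit [Fintype Λ] [Fintype V] [DecidableEq Λ] [DecidableEq V] in
/-- Entries of the padded matrix at encoded indices. [folklore] -/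
private theorem padded_enc (A : Matrix V V R) {decLab : Λ → Option V} {encLab : V → Λ}
    (hde : ∀ p, decLab (encLab p) = some p) (p q : V) : padded A decLab (encLab p) (encLab q) = A p q := by
  simp [padded, hde]

omit [Fintype Λ] [Fintype V] [DecidableEq Λ] [DecidableEq V] in
/-- Rows outside the image vanish. [folklore] -/
private theorem padded_of_none_left (A : Matrix V V R) {decLab : Λ → Option V} {x : Λ} (hx : decLab x = none)
    (y : Λ) : padded A decLab x y = 0 := by
  simp [padded, hx]

/-- **Powers of the padded matrix** at encoded indices are the powers of `A` (labels outside the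
image are isolated vertices, so walks between vertices never leave the image).
[cite: ChatterjeeTengse2023, Claims 37–38 (v1; p0012.txt:L63, p0012.txt:L77–L79)] -/
theorem padded_pow_enc (A : Matrix V V R) {decLab : Λ → Option V} {encLab : V → Λ}
    (hde : ∀ p, decLab (encLab p) = some p) (hed : ∀ x p, decLab x = some p → x = encLab p) (m : ℕ) (p q : V) :
    (padded A decLab ^ m) (encLab p) (encLab q) = (A ^ m) p q := by
  have hinj : Function.Injective encLab := fun p p' h => by
    have := hde p; rw [h, hde p'] at this; exact (Option.some.inj this).symm
  induction m generalizing q with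
  | zero =>
    simp [Matrix.one_apply, hinj.eq_iff]
  | succ m ih =>
    rw [pow_succ, pow_succ, Matrix.mul_apply, Matrix.mul_apply]
    -- restrict the sum over `Λ` to the image of `encLab`
    rw [← Finset.sum_subset (Finset.subset_univ (Finset.univ.image encLab)), Finset.sum_image
      (fun p _ p' _ h => hinj h)]
    · exact Finset.sum_congr rfl fun p' _ => by rw [ih, padded_enc A hde]
    · intro x _ hx
      cases hdx : decLab x with
      | none => rw [padded_of_none_left A hdx, mul_zero]
      | some p' =>
        exact absurd (Finset.mem_image.2 ⟨p', Finset.mem_univ _, (hed x p' hdx).symm⟩) hx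

end Padding

/-! ## Part D. Vertex labels: three blocks of `L` bits (layer, head, current vertex) -/

section Labels

open BitGadget

variable {L : ℕ}

/-- The `s`-th sub-block (`s = 0` layer, `s = 1` head, `s = 2` current vertex) of a block of
length `3·L` ("each vertex of the ABP is a vector of `3 log N` bits: `log N` each for `ℓ`, `i`
and `j`"). [cite: ChatterjeeTengse2023, Claim 37 (v1; p0012.txt:L49–L51)] -/
def part {α : Type*} (s : Fin 3) (w : Fin (3 * L) → α) : Fin L → α :=
  fun i => w (finProdFinEquiv (s, i))

/-- Gluing three sub-blocks. [cite: ChatterjeeTengse2023, Claim 37 (v1; p0012.txt:L49–L51)] -/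
def glue {α : Type*} (b : Fin 3 → Fin L → α) : Fin (3 * L) → α :=
  fun j => b (finProdFinEquiv.symm j).1 (finProdFinEquiv.symm j).2

/-- `part ∘ glue = id`. [cite: ChatterjeeTengse2023, Claim 37 (v1; p0012.txt:L49–L51)] -/
@[simp] theorem part_glue {α : Type*} (b : Fin 3 → Fin L → α) (s : Fin 3) : part s (glue b) = b s := by
  funext i; simp [part, glue]

/-- `glue ∘ part = id`. [cite: ChatterjeeTengse2023, Claim 37 (v1; p0012.txt:L49–L51)] -/
theorem glue_part {α : Type*} (w : Fin (3 * L) → α) : glue (fun s => part s w) = w := by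
  funext j
  exact congrArg w (finProdFinEquiv.apply_symm_apply j)

/-- The all-zero bit-vector encodes `0` ("`0…00` … the bit-vectors corresponding to the numbers").
[cite: ChatterjeeTengse2023, Claim 37 (v1; p0012.txt:L62)] -/
theorem bitsVal_zeros : ∀ L : ℕ, bitsVal L (fun _ => false) = 0
  | 0 => rfl
  | L + 1 => by
    rw [bitsVal]
    change (false).toNat + 2 * bitsVal L (fun _ => false) = 0
    rw [bitsVal_zeros L]; rfl

/-- The all-one bit-vector encodes `2^L − 1`. [cite: ChatterjeeTengse2023, Claim 37 (v1; p0012.txt:L62)] -/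
theorem bitsVal_ones : ∀ L : ℕ, bitsVal L (fun _ => true) = 2 ^ L - 1
  | 0 => rfl
  | L + 1 => by
    rw [bitsVal]
    change (true).toNat + 2 * bitsVal L (fun _ => true) = _
    rw [bitsVal_ones L, pow_succ]
    have := Nat.one_le_two_pow (n := L)
    simp only [Bool.toNat_true]
    omega

variable {n : ℕ}

/-- A bit-vector as an index `< n + 2 = 2^L`. [cite: ChatterjeeTengse2023, Def. 2.27 "binary representations" (v1: Def. 34)] -/
def bitsFin (hN : 2 ^ L = n + 2) (b : Fin L → Bool) : Fin (n + 2) :=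
  ⟨bitsVal L b, hN ▸ bitsVal_lt_two_pow L b⟩

/-- Binary representation is a bijection `{0,1}^L ≃ [0, 2^L)`. [cite: ChatterjeeTengse2023, Def. 2.27 "binary representations" (v1: Def. 34)] -/
theorem bitsFin_bijective (hN : 2 ^ L = n + 2) : Function.Bijective (bitsFin hN) := by
  rw [Fintype.bijective_iff_injective_and_card]
  refine ⟨fun a b h => bitsVal_injective L ?_, by simp [Fintype.card_fin, hN.symm]⟩
  have := congrArg Fin.val h
  simpa [bitsFin] using this

/-- The equivalence `{0,1}^L ≃ Fin (n + 2)` by binary representation. [cite: ChatterjeeTengse2023, Def. 2.27 "binary representations" (v1: Def. 34)] -/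
def bitsEquiv (hN : 2 ^ L = n + 2) : (Fin L → Bool) ≃ Fin (n + 2) :=
  Equiv.ofBijective _ (bitsFin_bijective hN)

/-- Its value. [cite: ChatterjeeTengse2023, Def. 2.27 "binary representations" (v1: Def. 34)] -/
@[simp] theorem bitsEquiv_apply_val (hN : 2 ^ L = n + 2) (b : Fin L → Bool) :
    ((bitsEquiv hN b : Fin (n + 2)) : ℕ) = bitsVal L b := rfl

/-- Its inverse decodes. [cite: ChatterjeeTengse2023, Def. 2.27 "binary representations" (v1: Def. 34)] -/
@[simp] theorem bitsVal_bitsEquiv_symm (hN : 2 ^ L = n + 2) (i : Fin (n + 2)) :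
    bitsVal L ((bitsEquiv hN).symm i) = i := by
  have h := congrArg Fin.val ((bitsEquiv hN).apply_symm_apply i)
  exact h

/-- The inverse on a representation. [cite: ChatterjeeTengse2023, Def. 2.27 "binary representations" (v1: Def. 34)] -/
theorem bitsEquiv_symm_mk (hN : 2 ^ L = n + 2) (b : Fin L → Bool) (h : bitsVal L b < n + 2) :
    (bitsEquiv hN).symm ⟨bitsVal L b, h⟩ = b := by
  rw [Equiv.symm_apply_eq]; rfl

/-- The matrix re-indexed by numbers instead of bit-vectors. [cite: ChatterjeeTengse2023, Def. 2.27 (v1: Def. 34)] -/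
def reidx (hN : 2 ^ L = n + 2) {R : Type*} (M : Matrix (Fin L → Bool) (Fin L → Bool) R) :
    Matrix (Fin (n + 2)) (Fin (n + 2)) R :=
  Matrix.reindex (bitsEquiv hN) (bitsEquiv hN) M

/-- Re-indexing keeps the determinant. [cite: ChatterjeeTengse2023, Def. 2.27 (v1: Def. 34)] -/
theorem det_reidx (hN : 2 ^ L = n + 2) {R : Type*} [CommRing R]
    (M : Matrix (Fin L → Bool) (Fin L → Bool) R) : (reidx hN M).det = M.det :=
  Matrix.det_reindex_self _ _

/-- Entries of the re-indexed matrix at representations. [cite: ChatterjeeTengse2023, Def. 2.27 (v1: Def. 34)] -/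
theorem entryN_reidx (hN : 2 ^ L = n + 2) {R : Type*} [CommRing R]
    (M : Matrix (Fin L → Bool) (Fin L → Bool) R) (a b : Fin L → Bool) :
    entryN (reidx hN M) (bitsVal L a) (bitsVal L b) = M a b := by
  have ha : bitsVal L a < n + 2 := hN ▸ bitsVal_lt_two_pow L a
  have hb : bitsVal L b < n + 2 := hN ▸ bitsVal_lt_two_pow L b
  rw [entryN, dif_pos ⟨ha, hb⟩, reidx, Matrix.reindex_apply, Matrix.submatrix_apply,
    bitsEquiv_symm_mk, bitsEquiv_symm_mk]

open MVState

/-- **Decoding a label** `(ℓ, t, u)`: a layer state if `ℓ ≤ n`; otherwise (`ℓ = n + 1 = 2^L − 1`)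
the source if `(t, u) = (0, 0)`, the sink if `(t, u) = (n+1, n+1)`, and no vertex else.
[cite: ChatterjeeTengse2023, Claim 37 "valid(u)" (v1; p0012.txt:L58–L63)] -/
def decLab (hN : 2 ^ L = n + 2) (x : Fin (3 * L) → Bool) : Option (MVState n) :=
  if h : bitsVal L (part 0 x) < n + 1 then
    some (mid n (⟨_, h⟩, (bitsFin hN (part 1 x), bitsFin hN (part 2 x))))
  else if bitsVal L (part 1 x) = 0 ∧ bitsVal L (part 2 x) = 0 then some (src n)
  else if bitsVal L (part 1 x) = n + 1 ∧ bitsVal L (part 2 x) = n + 1 then some (snk n)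
  else none

/-- **Encoding a vertex** as a label. [cite: ChatterjeeTengse2023, Claim 37 (v1; p0012.txt:L49–L51)] -/
def encLab (hN : 2 ^ L = n + 2) : MVState n → (Fin (3 * L) → Bool)
  | Sum.inl _ => glue ![fun _ => true, fun _ => false, fun _ => false]
  | Sum.inr (Sum.inl p) =>
      glue ![(bitsEquiv hN).symm (Fin.castLE (by omega) p.1), (bitsEquiv hN).symm p.2.1,
        (bitsEquiv hN).symm p.2.2]
  | Sum.inr (Sum.inr _) => glue ![fun _ => true, fun _ => true, fun _ => true]

/-- The source label `s = (1…1, 0…0, 0…0)`. [cite: ChatterjeeTengse2023, Claim 38 "s = (1,(1,1))" (v1; p0012.txt:L78)] -/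
def srcLab (L : ℕ) : Fin (3 * L) → Bool := glue ![fun _ => true, fun _ => false, fun _ => false]

/-- The sink label `t = (1…1, 1…1, 1…1)`. [cite: ChatterjeeTengse2023, Claim 38 "t = (N+1,(1,1))" (v1; p0012.txt:L78)] -/
def snkLab (L : ℕ) : Fin (3 * L) → Bool := glue ![fun _ => true, fun _ => true, fun _ => true]

/-- The source vertex carries the source label. [cite: ChatterjeeTengse2023, Claim 38 "s = (1,(1,1))" (v1; p0012.txt:L78)] -/
theorem encLab_src (hN : 2 ^ L = n + 2) : encLab hN (src n) = srcLab L := rfl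

/-- The sink vertex carries the sink label. [cite: ChatterjeeTengse2023, Claim 38 "t = (N+1,(1,1))" (v1; p0012.txt:L78)] -/
theorem encLab_snk (hN : 2 ^ L = n + 2) : encLab hN (snk n) = snkLab L := rfl

/-- `2^L − 1 = n + 1`. [folklore] -/
private theorem ones_val (hN : 2 ^ L = n + 2) : bitsVal L (fun _ => true) = n + 1 := by
  rw [bitsVal_ones]; omega

/-- Decoding an encoding. [cite: ChatterjeeTengse2023, Claim 37 (v1; p0012.txt:L49–L51)] -/
theorem decLab_encLab (hN : 2 ^ L = n + 2) (p : MVState n) : decLab hN (encLab hN p) = some p := by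
  rcases p with ⟨⟨⟩⟩ | ⟨⟨i, t, u⟩ | ⟨⟨⟩⟩⟩
  · simp [decLab, encLab, ones_val hN, bitsVal_zeros]
  · have hi : bitsVal L ((bitsEquiv hN).symm (Fin.castLE (by omega) i)) < n + 1 := by
      rw [bitsVal_bitsEquiv_symm]; exact i.isLt
    simp only [decLab, encLab, part_glue, Matrix.cons_val_zero, Matrix.cons_val_one, Matrix.cons_val,
      dif_pos hi, Option.some.injEq]
    congr 1
    refine Prod.ext (Fin.ext (by simp)) (Prod.ext ?_ ?_)
    · exact (bitsEquiv hN).apply_symm_apply t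
    · exact (bitsEquiv hN).apply_symm_apply u
  · simp [decLab, encLab, ones_val hN]

/-- A label is glued from its parts. [folklore] -/
private theorem eq_glue (x : Fin (3 * L) → Bool) : x = glue ![part 0 x, part 1 x, part 2 x] := by
  conv_lhs => rw [← glue_part x]
  congr 1
  funext s
  fin_cases s <;> rfl

/-- A decodable label is the encoding of its vertex. [cite: ChatterjeeTengse2023, Claim 37 (v1; p0012.txt:L49–L51)] -/
theorem eq_encLab_of_decLab (hN : 2 ^ L = n + 2) (x : Fin (3 * L) → Bool) (p : MVState n)
    (h : decLab hN x = some p) : x = encLab hN p := by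
  have hinj := bitsVal_injective L
  have h0 : bitsVal L (part 0 x) < n + 2 := hN ▸ bitsVal_lt_two_pow L _
  unfold decLab at h
  split_ifs at h with h1 h2 h3
  · obtain rfl := Option.some.inj h
    conv_lhs => rw [eq_glue x]
    rw [encLab]
    congr 1
    funext s
    fin_cases s
    · simp only [Fin.zero_eta, Matrix.cons_val_zero]
      rw [Equiv.eq_symm_apply]; rfl
    · exact ((bitsEquiv hN).symm_apply_apply (part 1 x)).symm
    · exact ((bitsEquiv hN).symm_apply_apply (part 2 x)).symm
  · obtain rfl := Option.some.inj h
    conv_lhs => rw [eq_glue x]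
    rw [encLab]
    congr 1
    funext s
    fin_cases s
    · exact hinj (by simp only [Fin.zero_eta, Matrix.cons_val_zero]; rw [ones_val hN]; omega)
    · exact hinj (by simpa [bitsVal_zeros] using h2.1)
    · exact hinj (by simpa [bitsVal_zeros] using h2.2)
  · obtain rfl := Option.some.inj h
    conv_lhs => rw [eq_glue x]
    rw [encLab]
    congr 1
    funext s
    fin_cases s
    · exact hinj (by simp only [Fin.zero_eta, Matrix.cons_val_zero]; rw [ones_val hN]; omega)
    · exact hinj (by simpa [ones_val hN] using h3.1)
    · exact hinj (by simpa [ones_val hN] using h3.2)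

end Labels

/-! ## Part E. The encoder of the program's adjacency matrix and its semantics -/

section Freshness

variable {τ : Type v} {L : ℕ}

/-- The blocks `r, c` of the encoder and the two label blocks `U, V` are distinct variables (one
injective map). [cite: ChatterjeeTengse2023, Def. 2.27–2.28 (v1: Def. 34–35)] -/
structure MVFresh (r c : Fin L → τ) (U V : Fin (3 * L) → τ) : Prop where
  /-- all of `r, c, U, V` are pairwise distinct variables -/
  inj : Function.Injective (Sum.elim (Sum.elim r c) (Sum.elim U V))

namespace MVFresh

variable {r c : Fin L → τ} {U V : Fin (3 * L) → τ} (F : MVFresh r c U V)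
include F

/-- `r` is injective. [cite: ChatterjeeTengse2023, Def. 2.27–2.28 (v1: Def. 34–35)] -/
theorem r_inj : Function.Injective r := fun l l' h => by
  have := @F.inj (Sum.inl (Sum.inl l)) (Sum.inl (Sum.inl l')) (by simpa using h)
  simpa using this

/-- `c` is injective. [cite: ChatterjeeTengse2023, Def. 2.27–2.28 (v1: Def. 34–35)] -/
theorem c_inj : Function.Injective c := fun l l' h => by
  have := @F.inj (Sum.inl (Sum.inr l)) (Sum.inl (Sum.inr l')) (by simpa using h)
  simpa using this

/-- `U` is injective. [cite: ChatterjeeTengse2023, Def. 2.27–2.28 (v1: Def. 34–35)] -/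
theorem U_inj : Function.Injective U := fun l l' h => by
  have := @F.inj (Sum.inr (Sum.inl l)) (Sum.inr (Sum.inl l')) (by simpa using h)
  simpa using this

/-- `V` is injective. [cite: ChatterjeeTengse2023, Def. 2.27–2.28 (v1: Def. 34–35)] -/
theorem V_inj : Function.Injective V := fun l l' h => by
  have := @F.inj (Sum.inr (Sum.inr l)) (Sum.inr (Sum.inr l')) (by simpa using h)
  simpa using this

/-- `r` misses `c`. [cite: ChatterjeeTengse2023, Def. 2.27–2.28 (v1: Def. 34–35)] -/
theorem r_ne_c (l l' : Fin L) : r l ≠ c l' := fun h => by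
  have := @F.inj (Sum.inl (Sum.inl l)) (Sum.inl (Sum.inr l')) (by simpa using h)
  simp at this

/-- `U` misses `V`. [cite: ChatterjeeTengse2023, Def. 2.27–2.28 (v1: Def. 34–35)] -/
theorem U_ne_V (l l' : Fin (3 * L)) : U l ≠ V l' := fun h => by
  have := @F.inj (Sum.inr (Sum.inl l)) (Sum.inr (Sum.inr l')) (by simpa using h)
  simp at this

/-- `r` misses `U`. [cite: ChatterjeeTengse2023, Def. 2.27–2.28 (v1: Def. 34–35)] -/
theorem r_ne_U (l : Fin L) (l' : Fin (3 * L)) : r l ≠ U l' := fun h => by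
  have := @F.inj (Sum.inl (Sum.inl l)) (Sum.inr (Sum.inl l')) (by simpa using h)
  simp at this

/-- `r` misses `V`. [cite: ChatterjeeTengse2023, Def. 2.27–2.28 (v1: Def. 34–35)] -/
theorem r_ne_V (l : Fin L) (l' : Fin (3 * L)) : r l ≠ V l' := fun h => by
  have := @F.inj (Sum.inl (Sum.inl l)) (Sum.inr (Sum.inr l')) (by simpa using h)
  simp at this

/-- `c` misses `U`. [cite: ChatterjeeTengse2023, Def. 2.27–2.28 (v1: Def. 34–35)] -/
theorem c_ne_U (l : Fin L) (l' : Fin (3 * L)) : c l ≠ U l' := fun h => by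
  have := @F.inj (Sum.inl (Sum.inr l)) (Sum.inr (Sum.inl l')) (by simpa using h)
  simp at this

/-- `c` misses `V`. [cite: ChatterjeeTengse2023, Def. 2.27–2.28 (v1: Def. 34–35)] -/
theorem c_ne_V (l : Fin L) (l' : Fin (3 * L)) : c l ≠ V l' := fun h => by
  have := @F.inj (Sum.inl (Sum.inr l)) (Sum.inr (Sum.inr l')) (by simpa using h)
  simp at this

end MVFresh

end Freshness

section Encoder

open BitGadget

variable {k : Type u} [CommRing k] {τ : Type v} [DecidableEq τ] {L : ℕ}

/-- The gadget inputs read off the `s`-th sub-block of a label block of variables.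
[cite: ChatterjeeTengse2023, Claim 37 (v1; p0012.txt:L49–L57)] -/
def Xp (s : Fin 3) (U : Fin (3 * L) → τ) : Fin L → MvPolynomial τ k := fun i => X (part s U i)

/-- A constant bit-vector as gadget input ("`n̄`, `0…00` and `0…01` are the bit-vectors
corresponding to the numbers"). [cite: ChatterjeeTengse2023, Claim 37 (v1; p0012.txt:L62)] -/
def kbits (b : Fin L → Bool) : Fin L → MvPolynomial τ k := fun i => bit (b i)

/-- **A renamed copy of the encoder**: `C(x, ρr, ρc)` — the encoder `E` with its row block `r`
renamed to `ρr` and its column block `c` to `ρc` (the printed `C(x, j_u, j_v)`, `C(x, i_u, j_u)`).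
[cite: ChatterjeeTengse2023, Claim 37 (v1; p0012.txt:L53–L57)] -/
def copyPoly (r c : Fin L → τ) (E : MvPolynomial τ k) (ρr ρc : Fin L → τ) : MvPolynomial τ k :=
  aeval (onBlock r (fun i => X (ρr i)) (onBlock c (fun i => X (ρc i)) X)) E

variable (r c : Fin L → τ) (E : MvPolynomial τ k) (U V : Fin (3 * L) → τ)

/-- The sign selector of an edge into `v = (ℓ_v, t_v, u_v)`: `LT(u_v, t_v) − EQ(u_v, t_v)`
(`+1` continue, `−1` close the clow; the printed labels `M[j,k]` versus `−M[j,i]`).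
[cite: ChatterjeeTengse2023, Claim 37 (v1; p0012.txt:L41–L47)] -/
def selP : MvPolynomial τ k := BitGadget.LT L (Xp 2 V) (Xp 1 V) - EQ L (Xp 2 V) (Xp 1 V)

/-- One transition `(t_u, u_u) → (t_v, u_v)` of the transfer matrix, as a polynomial TEMPLATE in
the two matrix entries `m₁ = M[u_u, u_v]`, `m₂ = M[t_v, u_v]`:
`LT(u_u,t_u)·EQ(t_v,t_u)·sel(v)·m₁ + EQ(u_u,t_u)·LT(t_u,t_v)·sel(v)·m₂`
(continue/close the open clow from its current vertex, or open the next clow at a larger head).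
[cite: ChatterjeeTengse2023, Claim 37 (v1; p0012.txt:L41–L47, L53–L57)] -/
def transT (m₁ m₂ : MvPolynomial τ k) : MvPolynomial τ k :=
  BitGadget.LT L (Xp 2 U) (Xp 1 U) * EQ L (Xp 1 V) (Xp 1 U) * selP V * m₁ +
    EQ L (Xp 2 U) (Xp 1 U) * BitGadget.LT L (Xp 1 U) (Xp 1 V) * selP V * m₂

/-- `[u is the source label (1…1, 0…0, 0…0)]`. [cite: ChatterjeeTengse2023, Claim 37 "valid(u)" (v1; p0012.txt:L58–L63)] -/
def isSrcP : MvPolynomial τ k :=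
  EQ L (Xp 0 U) (kbits fun _ => true) * EQ L (Xp 1 U) (kbits fun _ => false) *
    EQ L (Xp 2 U) (kbits fun _ => false)

/-- `[u is the sink label (1…1, 1…1, 1…1)]`. [cite: ChatterjeeTengse2023, Claim 37 "valid(u)" (v1; p0012.txt:L58–L63)] -/
def isSnkP : MvPolynomial τ k :=
  EQ L (Xp 0 U) (kbits fun _ => true) * EQ L (Xp 1 U) (kbits fun _ => true) *
    EQ L (Xp 2 U) (kbits fun _ => true)

/-- `[ℓ_v = ℓ_u + 1 is an internal layer]`: `EQ(ℓ_v, INC(ℓ_u)) · (1 − EQ(ℓ_v, 0…0)) · (1 − EQ(ℓ_v, 1…1))`.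
[cite: ChatterjeeTengse2023, Claim 37 "EQ(ℓ_v, INC(ℓ_u))" (v1; p0012.txt:L53–L57)] -/
def isSuccP : MvPolynomial τ k :=
  EQ L (Xp 0 V) (INC L (Xp 0 U)) * (1 - EQ L (Xp 0 V) (kbits fun _ => false)) *
    (1 - EQ L (Xp 0 V) (kbits fun _ => true))

/-- `[ℓ_u is the last layer]`: `EQ(INC(ℓ_u), 1…1)`. [cite: ChatterjeeTengse2023, Claim 37 "EQ(ℓ_u, n̄)" (v1; p0012.txt:L56)] -/
def isLastP : MvPolynomial τ k := EQ L (INC L (Xp 0 U)) (kbits fun _ => true)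

/-- **The encoder template** in the two matrix entries `m₁, m₂` (the printed
`valid(u)·valid(v)·G(x,u,v)` with one product term per edge type): sink self-loop + source edges
into layer `0` − internal transitions one layer down + transitions from the last layer into the
sink. [cite: ChatterjeeTengse2023, Claim 37 (v1; p0012.txt:L49–L67)] -/
def mvEdgeT (m₁ m₂ : MvPolynomial τ k) : MvPolynomial τ k :=
  isSnkP U * isSnkP V +
    isSrcP U * EQ L (Xp 0 V) (kbits fun _ => false) * selP V * m₂ -
    isSuccP U V * transT U V m₁ m₂ +
    isLastP U * isSnkP V * transT U V m₁ m₂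

/-- **The encoder `Ĉ(x, u, v)` of the adjacency matrix of the program**: the template at the two
renamed copies `C(x, u_u, u_v)` and `C(x, t_v, u_v)` of the matrix encoder.
[cite: ChatterjeeTengse2023, Claim 37 (v1; p0012.txt:L49–L67)] -/
def mvEdge : MvPolynomial τ k :=
  mvEdgeT U V (copyPoly r c E (part 2 U) (part 2 V)) (copyPoly r c E (part 1 V) (part 2 V))

/-! ### Semantics at a pair of labels -/

variable {r c E U V}

/-- The substitution of the label bits `x, y` for the blocks `U, V` (the entries of `matOf U V`).
[cite: ChatterjeeTengse2023, Def. 2.27 (v1: Def. 34)] -/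
abbrev labSubst (U V : Fin (3 * L) → τ) (x y : Fin (3 * L) → Bool) : τ → MvPolynomial τ k :=
  onBlock U (fun l => bit (x l)) (onBlock V (fun l => bit (y l)) X)

omit [DecidableEq τ] in
/-- The two `0/1` vocabularies agree. [folklore] -/
private theorem bit_eq_bitVal (b : Bool) : (bit b : MvPolynomial τ k) = bitVal b := rfl

/-- Substituting into a `U`-variable. [cite: ChatterjeeTengse2023, Def. 2.27 (v1: Def. 34)] -/
theorem labSubst_U (F : MVFresh r c U V) (x y : Fin (3 * L) → Bool) (s : Fin 3) (i : Fin L) :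
    aeval (labSubst (k := k) U V x y) (Xp (k := k) s U i) = bitVal (part s x i) := by
  rw [Xp, aeval_X]
  change onBlock U _ _ (U (finProdFinEquiv (s, i))) = _
  rw [onBlock_blk F.U_inj]; rfl

/-- Substituting into a `V`-variable. [cite: ChatterjeeTengse2023, Def. 2.27 (v1: Def. 34)] -/
theorem labSubst_V (F : MVFresh r c U V) (x y : Fin (3 * L) → Bool) (s : Fin 3) (i : Fin L) :
    aeval (labSubst (k := k) U V x y) (Xp (k := k) s V i) = bitVal (part s y i) := by
  rw [Xp, aeval_X]
  change onBlock U _ _ (V (finProdFinEquiv (s, i))) = _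
  rw [onBlock_of_ne (fun l => F.U_ne_V l _), onBlock_blk F.V_inj]; rfl

omit [DecidableEq τ] in
/-- Substituting into a constant bit. [cite: ChatterjeeTengse2023, Def. 2.27 (v1: Def. 34)] -/
theorem labSubst_kbits [DecidableEq τ] (x y : Fin (3 * L) → Bool) (b : Fin L → Bool) (i : Fin L) :
    aeval (labSubst (k := k) U V x y) (kbits (k := k) b i) = bitVal (b i) := by
  rw [kbits, aeval_bit]; rfl

/-- **Substituting into a renamed copy of the encoder gives the matrix entry**:
`C(x, ρr, ρc)(bits) = M[bits at ρr, bits at ρc]` when `ρr, ρc` are sub-blocks of `U`/`V` and `E`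
does not mention `U, V`. [cite: ChatterjeeTengse2023, Claim 37 "C(x, j_u, j_v)" (v1; p0012.txt:L53–L57)] -/
theorem labSubst_copyPoly (F : MVFresh r c U V) (hE : ∀ v ∈ E.vars, (∀ l, U l ≠ v) ∧ ∀ l, V l ≠ v)
    (x y : Fin (3 * L) → Bool) {ρr ρc : Fin L → τ} {br bc : Fin L → Bool}
    (hr : ∀ i, aeval (labSubst (k := k) U V x y) (X (ρr i) : MvPolynomial τ k) = bit (br i))
    (hc : ∀ i, aeval (labSubst (k := k) U V x y) (X (ρc i) : MvPolynomial τ k) = bit (bc i)) :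
    aeval (labSubst (k := k) U V x y) (copyPoly r c E ρr ρc) = matOf r c E br bc := by
  rw [copyPoly, matOf, Matrix.of_apply, MvPolynomial.aeval_eq_bind₁, MvPolynomial.aeval_eq_bind₁,
    MvPolynomial.bind₁_bind₁, ← MvPolynomial.aeval_eq_bind₁, ← MvPolynomial.aeval_eq_bind₁]
  simp only [MvPolynomial.aeval_def]
  refine MvPolynomial.eval₂Hom_congr' rfl (fun v hv _ => ?_) rfl
  change MvPolynomial.bind₁ _ (onBlock r _ _ v) = onBlock r _ _ v
  by_cases hvr : ∃ l, r l = v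
  · obtain ⟨l, rfl⟩ := hvr
    rw [onBlock_blk F.r_inj, onBlock_blk F.r_inj, ← MvPolynomial.aeval_eq_bind₁]
    exact hr l
  · have hvr' : ∀ l, r l ≠ v := fun l h => hvr ⟨l, h⟩
    rw [onBlock_of_ne hvr', onBlock_of_ne hvr']
    by_cases hvc : ∃ l, c l = v
    · obtain ⟨l, rfl⟩ := hvc
      rw [onBlock_blk F.c_inj, onBlock_blk F.c_inj, ← MvPolynomial.aeval_eq_bind₁]
      exact hc l
    · have hvc' : ∀ l, c l ≠ v := fun l h => hvc ⟨l, h⟩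
      rw [onBlock_of_ne hvc', onBlock_of_ne hvc', MvPolynomial.bind₁_X_right, labSubst,
        onBlock_of_ne (fun l => (hE v hv).1 l), onBlock_of_ne (fun l => (hE v hv).2 l)]

/-- The `0/1` indicator of a decidable proposition (the values of the Boolean gadgets).
[cite: ChatterjeeTengse2023, Obs. 2.9 (v1: Obs. 17)] -/
def ι {R : Type*} [CommRing R] (P : Prop) [Decidable P] : R := bitVal (decide P)

/-- The numeric shape of one transition at `(t, u) → (t', u')` with `m₁ = M[u, u']`, `m₂ = M[t', u']`.
[cite: ChatterjeeTengse2023, Claim 37 (v1; p0012.txt:L41–L47)] -/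
def numTrans {R : Type*} [CommRing R] (m₁ m₂ : R) (t u t' u' : ℕ) : R :=
  ι (u < t) * ι (t' = t) * (ι (u' < t') - ι (u' = t')) * m₁ +
    ι (u = t) * ι (t < t') * (ι (u' < t') - ι (u' = t')) * m₂

/-- The numeric shape of the encoder's value at a pair of labels `(ℓ,t,u)`, `(ℓ',t',u')`, with
`m₁ = M[u, u']` and `m₂ = M[t', u']` (`N = 2^L`). [cite: ChatterjeeTengse2023, Claim 37 (v1; p0012.txt:L49–L67)] -/
def numEdge {R : Type*} [CommRing R] (N : ℕ) (m₁ m₂ : R) (ℓ t u ℓ' t' u' : ℕ) : R :=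
  ι (ℓ = N - 1) * ι (t = N - 1) * ι (u = N - 1) * (ι (ℓ' = N - 1) * ι (t' = N - 1) * ι (u' = N - 1)) +
    ι (ℓ = N - 1) * ι (t = 0) * ι (u = 0) * ι (ℓ' = 0) * (ι (u' < t') - ι (u' = t')) * m₂ -
    ι (ℓ' = (ℓ + 1) % N) * (1 - ι (ℓ' = 0)) * (1 - ι (ℓ' = N - 1)) * numTrans m₁ m₂ t u t' u' +
    ι ((ℓ + 1) % N = N - 1) * (ι (ℓ' = N - 1) * ι (t' = N - 1) * ι (u' = N - 1)) *
      numTrans m₁ m₂ t u t' u'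

/-- Equality of bit-vectors is equality of the numbers. [folklore] -/
private theorem decide_bits_eq (a b : Fin L → Bool) :
    decide (a = b) = decide (bitsVal L a = bitsVal L b) :=
  decide_eq_decide.2 (bitsVal_injective L).eq_iff.symm

/-- **Semantics of the encoder**: at the label bits `x, y` the encoder evaluates to `numEdge` of
the six numbers and the two matrix entries `M[u_x, u_y]`, `M[t_y, u_y]`, `M = matOf r c E`.
[cite: ChatterjeeTengse2023, Claim 37 "The correctness of this expression is easy to check" (v1; p0012.txt:L65)] -/
theorem matOf_mvEdge_apply (F : MVFresh r c U V)
    (hE : ∀ v ∈ E.vars, (∀ l, U l ≠ v) ∧ ∀ l, V l ≠ v) (x y : Fin (3 * L) → Bool) :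
    matOf U V (mvEdge r c E U V) x y =
      numEdge (2 ^ L) (matOf r c E (part 2 x) (part 2 y)) (matOf r c E (part 1 y) (part 2 y))
        (bitsVal L (part 0 x)) (bitsVal L (part 1 x)) (bitsVal L (part 2 x))
        (bitsVal L (part 0 y)) (bitsVal L (part 1 y)) (bitsVal L (part 2 y)) := by
  -- the substitution as a ring map, and its values on the atoms
  set g : MvPolynomial τ k →+* MvPolynomial τ k := (aeval (labSubst (k := k) U V x y)).toRingHom
    with hg
  have hU : ∀ (s : Fin 3) (i : Fin L), g (Xp s U i) = bitVal (part s x i) :=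
    fun s i => labSubst_U F x y s i
  have hV : ∀ (s : Fin 3) (i : Fin L), g (Xp s V i) = bitVal (part s y i) :=
    fun s i => labSubst_V F x y s i
  have hK : ∀ (b : Fin L → Bool) (i : Fin L), g (kbits b i) = bitVal (b i) :=
    fun b i => labSubst_kbits x y b i
  have hI : ∀ i : Fin L, g (INC L (Xp 0 U) i) = bitVal (incBits L (part 0 x) i) :=
    fun i => map_INC_eq_incBits g _ _ (hU 0) i
  -- gadget values
  have eUK : ∀ (s : Fin 3) (b : Fin L → Bool), g (EQ L (Xp s U) (kbits b)) =
      ι (bitsVal L (part s x) = bitsVal L b) := fun s b => by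
    rw [map_EQ_eq_indicator g _ _ _ _ (hU s) (hK b)]; exact congrArg bitVal (decide_bits_eq _ _)
  have eVK : ∀ (s : Fin 3) (b : Fin L → Bool), g (EQ L (Xp s V) (kbits b)) =
      ι (bitsVal L (part s y) = bitsVal L b) := fun s b => by
    rw [map_EQ_eq_indicator g _ _ _ _ (hV s) (hK b)]; exact congrArg bitVal (decide_bits_eq _ _)
  have eVI : g (EQ L (Xp 0 V) (INC L (Xp 0 U))) =
      ι (bitsVal L (part 0 y) = (bitsVal L (part 0 x) + 1) % 2 ^ L) := by
    rw [map_EQ_eq_indicator g _ _ _ _ (hV 0) hI, ← bitsVal_incBits]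
    exact congrArg bitVal (decide_bits_eq _ _)
  have eIK : ∀ b : Fin L → Bool, g (EQ L (INC L (Xp 0 U)) (kbits b)) =
      ι ((bitsVal L (part 0 x) + 1) % 2 ^ L = bitsVal L b) := fun b => by
    rw [map_EQ_eq_indicator g _ _ _ _ hI (hK b), ← bitsVal_incBits]
    exact congrArg bitVal (decide_bits_eq _ _)
  have eVU : ∀ s s' : Fin 3, g (EQ L (Xp s V) (Xp s' U)) =
      ι (bitsVal L (part s y) = bitsVal L (part s' x)) := fun s s' => by
    rw [map_EQ_eq_indicator g _ _ _ _ (hV s) (hU s')]; exact congrArg bitVal (decide_bits_eq _ _)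
  have eUU : ∀ s s' : Fin 3, g (EQ L (Xp s U) (Xp s' U)) =
      ι (bitsVal L (part s x) = bitsVal L (part s' x)) := fun s s' => by
    rw [map_EQ_eq_indicator g _ _ _ _ (hU s) (hU s')]; exact congrArg bitVal (decide_bits_eq _ _)
  have eVV : ∀ s s' : Fin 3, g (EQ L (Xp s V) (Xp s' V)) =
      ι (bitsVal L (part s y) = bitsVal L (part s' y)) := fun s s' => by
    rw [map_EQ_eq_indicator g _ _ _ _ (hV s) (hV s')]; exact congrArg bitVal (decide_bits_eq _ _)
  have lUU : ∀ s s' : Fin 3, g (BitGadget.LT L (Xp s U) (Xp s' U)) =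
      ι (bitsVal L (part s x) < bitsVal L (part s' x)) := fun s s' =>
    map_LT_eq_indicator g _ _ _ _ (hU s) (hU s')
  have lVV : ∀ s s' : Fin 3, g (BitGadget.LT L (Xp s V) (Xp s' V)) =
      ι (bitsVal L (part s y) < bitsVal L (part s' y)) := fun s s' =>
    map_LT_eq_indicator g _ _ _ _ (hV s) (hV s')
  have lUV : ∀ s s' : Fin 3, g (BitGadget.LT L (Xp s U) (Xp s' V)) =
      ι (bitsVal L (part s x) < bitsVal L (part s' y)) := fun s s' =>
    map_LT_eq_indicator g _ _ _ _ (hU s) (hV s')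
  -- the two copies of the encoder
  have c1 : g (copyPoly r c E (part 2 U) (part 2 V)) = matOf r c E (part 2 x) (part 2 y) :=
    labSubst_copyPoly F hE x y (fun i => labSubst_U F x y 2 i) (fun i => labSubst_V F x y 2 i)
  have c2 : g (copyPoly r c E (part 1 V) (part 2 V)) = matOf r c E (part 1 y) (part 2 y) :=
    labSubst_copyPoly F hE x y (fun i => labSubst_V F x y 1 i) (fun i => labSubst_V F x y 2 i)
  -- assemble
  have h2L : 2 ^ L - 1 = bitsVal L (fun _ => true) := (bitsVal_ones L).symm
  change g (mvEdge r c E U V) = _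
  simp only [mvEdge, mvEdgeT, isSnkP, isSrcP, isSuccP, isLastP, transT, selP, map_add, map_sub,
    map_mul, map_one, eUK, eVK, eVI, eIK, eVU, eUU, eVV, lUU, lVV, lUV, c1, c2, numEdge, numTrans, h2L,
    bitsVal_zeros]

/-! ### The encoder's values ARE the (padded) adjacency matrix of the program -/

section Compare

open MVState

variable {R : Type*} [CommRing R] {n : ℕ}

/-- `ι` of a true / false proposition. [folklore] -/
private theorem ι_pos {P : Prop} [Decidable P] (h : P) : (ι P : R) = 1 := by simp [ι, h]
/-- `ι` of a false proposition. [folklore] -/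
private theorem ι_neg {P : Prop} [Decidable P] (h : ¬P) : (ι P : R) = 0 := by simp [ι, h]

/-- The sign selector in indicator form. [cite: MahajanVinay1997, §3] -/
theorem selW_eq (t' u' : ℕ) : (selW t' u' : R) = ι (u' < t') - ι (u' = t') := by
  unfold selW
  by_cases h1 : u' < t'
  · rw [if_pos h1, ι_pos (R := R) h1, ι_neg (R := R) (by omega), sub_zero]
  · rw [if_neg h1, ι_neg (R := R) h1]
    by_cases h2 : u' = t'
    · rw [if_pos h2, ι_pos (R := R) h2]; ring
    · rw [if_neg h2, ι_neg (R := R) h2]; ring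

/-- The transition in indicator form. [cite: MahajanVinay1997, §3] -/
theorem numTrans_eq_transN (M : Matrix (Fin (n + 2)) (Fin (n + 2)) R) (t u t' u' : ℕ) :
    numTrans (entryN M u u') (entryN M t' u') t u t' u' = transN M t u t' u' := by
  unfold numTrans transN
  rw [← selW_eq]
  by_cases h1 : u < t
  · rw [if_pos h1, ι_pos (R := R) h1, ι_neg (R := R) (show ¬u = t by omega)]
    by_cases h2 : t' = t
    · rw [if_pos h2, ι_pos (R := R) h2]; ring
    · rw [if_neg h2, ι_neg (R := R) h2]; ring
  · rw [if_neg h1, ι_neg (R := R) h1]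
    by_cases h2 : u = t
    · rw [if_pos h2, ι_pos (R := R) h2]
      by_cases h3 : t < t'
      · rw [if_pos h3, ι_pos (R := R) h3]; ring
      · rw [if_neg h3, ι_neg (R := R) h3]; ring
    · rw [if_neg h2, ι_neg (R := R) h2]; ring

/-- **The encoder encodes the program**: the numeric value at the labels `x, y` is the entry of
the zero-padded adjacency matrix of the signed Mahajan–Vinay program of the re-indexed matrix.
[cite: ChatterjeeTengse2023, Claim 37 "The correctness of this expression is easy to check using the description of the ABP" (v1; p0012.txt:L65)] -/
theorem numEdge_eq_padded (hN : 2 ^ L = n + 2) (M : Matrix (Fin L → Bool) (Fin L → Bool) R)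
    (x y : Fin (3 * L) → Bool) :
    numEdge (2 ^ L) (M (part 2 x) (part 2 y)) (M (part 1 y) (part 2 y))
        (bitsVal L (part 0 x)) (bitsVal L (part 1 x)) (bitsVal L (part 2 x))
        (bitsVal L (part 0 y)) (bitsVal L (part 1 y)) (bitsVal L (part 2 y)) =
      padded (mvAdj (reidx hN M)) (decLab hN) x y := by
  rw [← entryN_reidx hN M (part 2 x) (part 2 y), ← entryN_reidx hN M (part 1 y) (part 2 y), hN]
  have hb : ∀ (s : Fin 3) (z : Fin (3 * L) → Bool), bitsVal L (part s z) < n + 2 :=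
    fun s z => hN ▸ bitsVal_lt_two_pow L _
  -- abbreviate the six numbers
  have hℓ := hb 0 x; have ht := hb 1 x; have hu := hb 2 x
  have hℓ' := hb 0 y; have ht' := hb 1 y; have hu' := hb 2 y
  set M' := reidx hN M
  set ℓ := bitsVal L (part 0 x) with hℓdef
  set t := bitsVal L (part 1 x) with htdef
  set u := bitsVal L (part 2 x) with hudef
  set ℓ' := bitsVal L (part 0 y) with hℓ'def
  set t' := bitsVal L (part 1 y) with ht'def
  set u' := bitsVal L (part 2 y) with hu'def
  have hF1x : (bitsFin hN (part 1 x) : ℕ) = t := rfl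
  have hF2x : (bitsFin hN (part 2 x) : ℕ) = u := rfl
  have hF1y : (bitsFin hN (part 1 y) : ℕ) = t' := rfl
  have hF2y : (bitsFin hN (part 2 y) : ℕ) = u' := rfl
  have h21 : n + 2 - 1 = n + 1 := rfl
  simp only [numEdge, numTrans_eq_transN, h21]
  by_cases hx : ℓ < n + 1
  · -- `x` is a layer state
    have hdx : decLab hN x = some (mid n (⟨ℓ, hx⟩, (bitsFin hN (part 1 x), bitsFin hN (part 2 x)))) := by
      rw [decLab, dif_pos hx]
    have hmod : (ℓ + 1) % (n + 2) = ℓ + 1 := Nat.mod_eq_of_lt (by omega)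
    rw [ι_neg (R := R) (show ¬ℓ = n + 1 by omega), hmod]
    by_cases hy : ℓ' < n + 1
    · -- layer → layer
      have hdy : decLab hN y =
          some (mid n (⟨ℓ', hy⟩, (bitsFin hN (part 1 y), bitsFin hN (part 2 y)))) := by
        rw [decLab, dif_pos hy]
      rw [padded, Matrix.of_apply, hdx, hdy]
      dsimp only
      rw [mvAdj_mid_mid, ι_neg (R := R) (show ¬ℓ' = n + 1 by omega), hF1x, hF2x, hF1y, hF2y]
      by_cases h1 : ℓ' = ℓ + 1
      · rw [ι_pos (R := R) h1, if_pos h1, ι_neg (R := R) (show ¬ℓ' = 0 by omega)]; ring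
      · rw [ι_neg (R := R) h1, if_neg h1]; ring
    · have hℓ'e : ℓ' = n + 1 := by omega
      rw [ι_pos (R := R) hℓ'e, ι_neg (R := R) (show ¬ℓ' = 0 by omega)]
      by_cases hyt : t' = n + 1 ∧ u' = n + 1
      · -- layer → sink
        have hdy : decLab hN y = some (snk n) := by
          rw [decLab, dif_neg hy, if_neg (by omega), if_pos hyt]
        rw [padded, Matrix.of_apply, hdx, hdy]
        dsimp only
        rw [mvAdj_mid_snk, ι_pos (R := R) hyt.1, ι_pos (R := R) hyt.2, hF1x, hF2x]
        by_cases h1 : ℓ = n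
        · rw [if_pos h1, ι_pos (R := R) (show ℓ + 1 = n + 1 by omega), hyt.1, hyt.2]; ring
        · rw [if_neg h1, ι_neg (R := R) (show ¬ℓ + 1 = n + 1 by omega)]; ring
      · -- layer → source or junk label: no edge
        have hrhs : padded (mvAdj M') (decLab hN) x y = 0 := by
          rw [padded, Matrix.of_apply, hdx]
          unfold decLab
          rw [dif_neg hy]
          split_ifs <;> rfl
        rw [hrhs]
        by_cases h2 : t' = n + 1
        · rw [ι_pos (R := R) h2, ι_neg (R := R) (show ¬u' = n + 1 from fun h => hyt ⟨h2, h⟩)]; ring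
        · rw [ι_neg (R := R) h2]; ring
  · -- `x` is not a layer state: `ℓ = n + 1`
    have hℓe : ℓ = n + 1 := by omega
    have hmod : (ℓ + 1) % (n + 2) = 0 := by rw [hℓe, Nat.mod_self]
    rw [ι_pos (R := R) hℓe, hmod, ι_neg (R := R) (show ¬(0 = n + 1) by omega)]
    have hk0 : (ι (ℓ' = 0) : R) * (1 - ι (ℓ' = 0)) = 0 := by
      by_cases h0 : ℓ' = 0
      · rw [ι_pos (R := R) h0]; ring
      · rw [ι_neg (R := R) h0]; ring
    rw [hk0, zero_mul, zero_mul, sub_zero]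
    by_cases hxs : t = 0 ∧ u = 0
    · -- `x` is the source
      have hdx : decLab hN x = some (src n) := by rw [decLab, dif_neg hx, if_pos hxs]
      rw [ι_pos (R := R) hxs.1, ι_pos (R := R) hxs.2, ι_neg (R := R) (show ¬t = n + 1 by omega)]
      by_cases hy : ℓ' < n + 1
      · -- source → layer
        have hdy : decLab hN y =
            some (mid n (⟨ℓ', hy⟩, (bitsFin hN (part 1 y), bitsFin hN (part 2 y)))) := by
          rw [decLab, dif_pos hy]
        rw [padded, Matrix.of_apply, hdx, hdy]
        dsimp only
        rw [mvAdj_src_mid, ι_neg (R := R) (show ¬ℓ' = n + 1 by omega), selW_eq, hF1y, hF2y]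
        by_cases h0 : ℓ' = 0
        · rw [ι_pos (R := R) h0, if_pos h0]; ring
        · rw [ι_neg (R := R) h0, if_neg h0]; ring
      · -- source → source / sink / junk: no edge
        have hrhs : padded (mvAdj M') (decLab hN) x y = 0 := by
          rw [padded, Matrix.of_apply, hdx]
          unfold decLab
          rw [dif_neg hy]
          split_ifs <;> rfl
        rw [hrhs, ι_neg (R := R) (show ¬ℓ' = 0 by omega)]
        ring
    · by_cases hxt : t = n + 1 ∧ u = n + 1
      · -- `x` is the sink
        have hdx : decLab hN x = some (snk n) := by rw [decLab, dif_neg hx, if_neg hxs, if_pos hxt]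
        rw [ι_pos (R := R) hxt.1, ι_pos (R := R) hxt.2, ι_neg (R := R) (show ¬t = 0 by omega)]
        by_cases hyt : t' = n + 1 ∧ u' = n + 1
        · by_cases hy : ℓ' < n + 1
          · -- sink → layer
            have hdy : decLab hN y =
                some (mid n (⟨ℓ', hy⟩, (bitsFin hN (part 1 y), bitsFin hN (part 2 y)))) := by
              rw [decLab, dif_pos hy]
            rw [padded, Matrix.of_apply, hdx, hdy]
            dsimp only
            rw [mvAdj_snk_mid, ι_neg (R := R) (show ¬ℓ' = n + 1 by omega)]; ring
          · -- sink → sink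
            have hdy : decLab hN y = some (snk n) := by
              rw [decLab, dif_neg hy, if_neg (by omega), if_pos hyt]
            rw [padded, Matrix.of_apply, hdx, hdy]
            dsimp only
            rw [mvAdj_snk_snk, ι_pos (R := R) (show ℓ' = n + 1 by omega), ι_pos (R := R) hyt.1, ι_pos (R := R) hyt.2]; ring
        · -- sink → not the sink
          have hrhs : padded (mvAdj M') (decLab hN) x y = 0 := by
            rw [padded, Matrix.of_apply, hdx]
            unfold decLab
            split_ifs <;> rfl
          rw [hrhs]
          by_cases h2 : t' = n + 1
          · rw [ι_pos (R := R) h2, ι_neg (R := R) (show ¬u' = n + 1 from fun h => hyt ⟨h2, h⟩)]; ring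
          · rw [ι_neg (R := R) h2]; ring
      · -- `x` is a junk label: no edges at all
        have hdx : decLab hN x = none := by rw [decLab, dif_neg hx, if_neg hxs, if_neg hxt]
        rw [padded_of_none_left _ hdx]
        have hA : (ι (t = n + 1) : R) * ι (u = n + 1) = 0 := by
          by_cases h2 : t = n + 1
          · rw [ι_neg (R := R) (show ¬u = n + 1 from fun h => hxt ⟨h2, h⟩), mul_zero]
          · rw [ι_neg (R := R) h2, zero_mul]
        have hB : (ι (t = 0) : R) * ι (u = 0) = 0 := by
          by_cases h2 : t = 0
          · rw [ι_neg (R := R) (show ¬u = 0 from fun h => hxs ⟨h2, h⟩), mul_zero]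
          · rw [ι_neg (R := R) h2, zero_mul]
        linear_combination (ι (ℓ' = n + 1) * ι (t' = n + 1) * ι (u' = n + 1) : R) * hA +
          ι (ℓ' = 0) * (ι (u' < t') - ι (u' = t')) * entryN M' t' u' * hB

end Compare

/-! ### The encoder mentions only the encoder's variables and the label blocks -/

section Vars

omit [DecidableEq τ] in
/-- `vars (X n) ⊆ {n}` without a nontriviality assumption. [folklore] -/
private theorem notMem_vars_X {w v : τ} (h : v ≠ w) : w ∉ (X v : MvPolynomial τ k).vars := by
  classical
  intro hv
  rw [MvPolynomial.vars_def, Multiset.mem_toFinset] at hv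
  exact h (Multiset.mem_singleton.1 (Multiset.mem_of_le (degrees_X' v) hv)).symm

omit [DecidableEq τ] in
/-- Products. [folklore] -/
private theorem notMem_vars_mul {w : τ} {p q : MvPolynomial τ k} (hp : w ∉ p.vars) (hq : w ∉ q.vars) :
    w ∉ (p * q).vars := fun h => by
  classical
  rcases Finset.mem_union.1 (MvPolynomial.vars_mul p q h) with h | h
  · exact hp h
  · exact hq h

omit [DecidableEq τ] in
/-- Sums. [folklore] -/
private theorem notMem_vars_add {w : τ} {p q : MvPolynomial τ k} (hp : w ∉ p.vars) (hq : w ∉ q.vars) :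
    w ∉ (p + q).vars := fun h => by
  classical
  rcases Finset.mem_union.1 (MvPolynomial.vars_add_subset p q h) with h | h
  · exact hp h
  · exact hq h

omit [DecidableEq τ] in
/-- Differences. [folklore] -/
private theorem notMem_vars_sub {w : τ} {p q : MvPolynomial τ k} (hp : w ∉ p.vars) (hq : w ∉ q.vars) :
    w ∉ (p - q).vars := fun h => by
  classical
  rcases Finset.mem_union.1 (MvPolynomial.vars_sub_subset p h) with h | h
  · exact hp h
  · exact hq h

omit [DecidableEq τ] in
/-- `1`. [folklore] -/
private theorem notMem_vars_one {w : τ} : w ∉ (1 : MvPolynomial τ k).vars := by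
  rw [← MvPolynomial.C_1, MvPolynomial.vars_C]; exact Finset.notMem_empty w

omit [DecidableEq τ] in
/-- `eqBit`. [cite: ChatterjeeTengse2023, Obs. 2.9 (v1: Obs. 17)] -/
private theorem notMem_vars_eqBit {w : τ} {a b : MvPolynomial τ k} (ha : w ∉ a.vars) (hb : w ∉ b.vars) :
    w ∉ (eqBit a b).vars :=
  notMem_vars_add (notMem_vars_mul ha hb)
    (notMem_vars_mul (notMem_vars_sub notMem_vars_one ha) (notMem_vars_sub notMem_vars_one hb))

omit [DecidableEq τ] in
/-- `EQ` mentions only its inputs' variables. [cite: ChatterjeeTengse2023, Obs. 2.9 (v1: Obs. 17)] -/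
theorem notMem_vars_EQ {w : τ} : ∀ (ℓ : ℕ) {a b : Fin ℓ → MvPolynomial τ k}
    (_ : ∀ i, w ∉ (a i).vars) (_ : ∀ i, w ∉ (b i).vars), w ∉ (EQ ℓ a b).vars
  | 0, _, _, _, _ => by rw [BitGadget.EQ]; exact notMem_vars_one
  | ℓ + 1, a, b, ha, hb =>
    notMem_vars_mul (notMem_vars_eqBit (ha 0) (hb 0)) (notMem_vars_EQ ℓ (fun i => ha _) (fun i => hb _))

omit [DecidableEq τ] in
/-- `LT` mentions only its inputs' variables. [cite: ChatterjeeTengse2023, Obs. 2.9 (v1: Obs. 17)] -/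
theorem notMem_vars_LT {w : τ} : ∀ (ℓ : ℕ) {a b : Fin ℓ → MvPolynomial τ k}
    (_ : ∀ i, w ∉ (a i).vars) (_ : ∀ i, w ∉ (b i).vars), w ∉ (BitGadget.LT ℓ a b).vars
  | 0, _, _, _, _ => by rw [BitGadget.LT, MvPolynomial.vars_0]; exact Finset.notMem_empty w
  | ℓ + 1, a, b, ha, hb =>
    notMem_vars_add
      (notMem_vars_mul (notMem_vars_mul (notMem_vars_sub notMem_vars_one (ha 0)) (hb 0))
        (notMem_vars_EQ ℓ (fun i => ha _) (fun i => hb _)))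
      (notMem_vars_LT ℓ (fun i => ha _) (fun i => hb _))

omit [DecidableEq τ] in
/-- `INC` mentions only its input's variables. [cite: ChatterjeeTengse2023, Obs. 2.9 (v1: Obs. 17)] -/
theorem notMem_vars_INC {w : τ} : ∀ (ℓ : ℕ) {a : Fin ℓ → MvPolynomial τ k}
    (_ : ∀ i, w ∉ (a i).vars) (i : Fin ℓ), w ∉ (INC ℓ a i).vars
  | 0, _, _, i => i.elim0
  | ℓ + 1, a, ha, i => by
    refine Fin.cases ?_ (fun j => ?_) i
    · simp only [INC, Fin.cons_zero]
      exact notMem_vars_sub notMem_vars_one (ha 0)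
    · simp only [INC, Fin.cons_succ]
      exact notMem_vars_add (notMem_vars_mul (ha 0) (notMem_vars_INC ℓ (fun i => ha _) j))
        (notMem_vars_mul (notMem_vars_sub notMem_vars_one (ha 0)) (ha _))

variable {w : τ}

omit [DecidableEq τ] in
/-- A label variable block not containing `w`. [folklore] -/
private theorem notMem_vars_Xp {W : Fin (3 * L) → τ} (hW : ∀ l, W l ≠ w) (s : Fin 3) (i : Fin L) :
    w ∉ (Xp (k := k) s W i).vars :=
  notMem_vars_X (hW _)

omit [DecidableEq τ] in
/-- Constant bits mention no variable. [folklore] -/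
private theorem notMem_vars_kbits (b : Fin L → Bool) (i : Fin L) : w ∉ (kbits (k := k) b i).vars := by
  unfold kbits bit
  cases b i
  · simp
  · exact notMem_vars_one

/-- A renamed copy of the encoder mentions only `E`'s variables and the new blocks.
[cite: ChatterjeeTengse2023, Claim 37 (v1; p0012.txt:L53–L57)] -/
theorem notMem_vars_copyPoly {ρr ρc : Fin L → τ} (hE : w ∉ E.vars) (hr : ∀ l, ρr l ≠ w)
    (hc : ∀ l, ρc l ≠ w) : w ∉ (copyPoly r c E ρr ρc).vars := by
  intro hw
  rw [copyPoly, MvPolynomial.aeval_eq_bind₁] at hw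
  obtain ⟨v, hv, hwv⟩ := Finset.mem_biUnion.1 (MvPolynomial.vars_bind₁ _ _ hw)
  revert hwv
  change w ∉ (onBlock r (fun i => (X (ρr i) : MvPolynomial τ k)) (onBlock c (fun i => X (ρc i)) X) v).vars
  unfold onBlock
  split_ifs
  · exact notMem_vars_X (hr _)
  · exact notMem_vars_X (hc _)
  · exact notMem_vars_X (fun h => hE (h ▸ hv))

/-- **The encoder `Ĉ` mentions no variable outside `E.vars ∪ U ∪ V`** (so fresh workspace for the
repeated squaring can be chosen disjoint from it).
[cite: ChatterjeeTengse2023, Claims 37–38 (v1; p0012.txt:L49–L67, p0013.txt:L18–L21)] -/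
theorem notMem_vars_mvEdge (hE : w ∉ E.vars) (hU : ∀ l, U l ≠ w) (hV : ∀ l, V l ≠ w) :
    w ∉ (mvEdge r c E U V).vars := by
  have xU := notMem_vars_Xp (k := k) hU
  have xV := notMem_vars_Xp (k := k) hV
  have kb := fun b => notMem_vars_kbits (k := k) (L := L) (w := w) b
  have c1 : w ∉ (copyPoly r c E (part 2 U) (part 2 V)).vars :=
    notMem_vars_copyPoly hE (fun l => hU _) (fun l => hV _)
  have c2 : w ∉ (copyPoly r c E (part 1 V) (part 2 V)).vars :=
    notMem_vars_copyPoly hE (fun l => hV _) (fun l => hV _)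
  have sel : w ∉ (selP (k := k) V).vars :=
    notMem_vars_sub (notMem_vars_LT L (xV 2) (xV 1)) (notMem_vars_EQ L (xV 2) (xV 1))
  have tr : w ∉ (transT U V (copyPoly r c E (part 2 U) (part 2 V))
      (copyPoly r c E (part 1 V) (part 2 V))).vars :=
    notMem_vars_add
      (notMem_vars_mul (notMem_vars_mul (notMem_vars_mul (notMem_vars_LT L (xU 2) (xU 1))
        (notMem_vars_EQ L (xV 1) (xU 1))) sel) c1)
      (notMem_vars_mul (notMem_vars_mul (notMem_vars_mul (notMem_vars_EQ L (xU 2) (xU 1))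
        (notMem_vars_LT L (xU 1) (xV 1))) sel) c2)
  have snkU : w ∉ (isSnkP (k := k) U).vars :=
    notMem_vars_mul (notMem_vars_mul (notMem_vars_EQ L (xU 0) (kb _)) (notMem_vars_EQ L (xU 1) (kb _)))
      (notMem_vars_EQ L (xU 2) (kb _))
  have snkV : w ∉ (isSnkP (k := k) V).vars :=
    notMem_vars_mul (notMem_vars_mul (notMem_vars_EQ L (xV 0) (kb _)) (notMem_vars_EQ L (xV 1) (kb _)))
      (notMem_vars_EQ L (xV 2) (kb _))
  have srcU : w ∉ (isSrcP (k := k) U).vars :=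
    notMem_vars_mul (notMem_vars_mul (notMem_vars_EQ L (xU 0) (kb _)) (notMem_vars_EQ L (xU 1) (kb _)))
      (notMem_vars_EQ L (xU 2) (kb _))
  have inc : ∀ i, w ∉ (INC L (Xp (k := k) 0 U) i).vars := notMem_vars_INC L (xU 0)
  have succ : w ∉ (isSuccP (k := k) U V).vars :=
    notMem_vars_mul (notMem_vars_mul (notMem_vars_EQ L (xV 0) inc)
      (notMem_vars_sub notMem_vars_one (notMem_vars_EQ L (xV 0) (kb _))))
      (notMem_vars_sub notMem_vars_one (notMem_vars_EQ L (xV 0) (kb _)))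
  have last : w ∉ (isLastP (k := k) U).vars := notMem_vars_EQ L inc (kb _)
  exact notMem_vars_add
    (notMem_vars_sub
      (notMem_vars_add (notMem_vars_mul snkU snkV)
        (notMem_vars_mul (notMem_vars_mul (notMem_vars_mul srcU (notMem_vars_EQ L (xV 0) (kb _))) sel)
          c2))
      (notMem_vars_mul succ tr))
    (notMem_vars_mul (notMem_vars_mul last snkV) tr)

end Vars

/-! ### The main identity: `(matOf U V Ĉ)^P (s, t) = det (matOf r c E)` -/

open MVState in
/-- **The determinant as the `(s, t)` entry of a power of an explicitly encoded matrix**: for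
every `P ≥ N = 2^L`, the `(source, sink)` entry of the `P`-th power of the matrix encoded by
`mvEdge r c E U V` is the determinant of the matrix encoded by `E` ("the polynomial computed by
the ABP is just the `(s,t)`-th entry of the matrix `A^N`" — Claim 37's program computes `det(M)`;
with `N` a power of two this is what the repeated squaring of Claim 38 consumes).
[cite: ChatterjeeTengse2023, Claims 37–38 (v1; p0012.txt:L30–L34, L77–L79, p0013.txt:L6–L7)] -/
theorem matOf_mvEdge_pow_apply_src_snk (hL : 0 < L) (F : MVFresh r c U V)
    (hE : ∀ v ∈ E.vars, (∀ l, U l ≠ v) ∧ ∀ l, V l ≠ v) {P : ℕ} (hP : 2 ^ L ≤ P) :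
    (matOf U V (mvEdge r c E U V) ^ P) (srcLab L) (snkLab L) = (matOf r c E).det := by
  obtain ⟨n, hN⟩ : ∃ n, 2 ^ L = n + 2 :=
    ⟨2 ^ L - 2, by have := Nat.one_lt_two_pow_iff.2 hL.ne'; omega⟩
  have hmat : matOf U V (mvEdge r c E U V) = padded (mvAdj (reidx hN (matOf r c E))) (decLab hN) := by
    ext x y
    rw [matOf_mvEdge_apply F hE, numEdge_eq_padded hN]
  rw [hmat, ← encLab_src hN, ← encLab_snk hN, padded_pow_enc _ (decLab_encLab hN) (eq_encLab_of_decLab hN),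
    mvAdj_pow_src_snk _ (by omega), det_reidx]

end Encoder

/-! ## Part F. A constant-free circuit for the encoder: two copies of `C` plus `O(L²)` gates -/

section Circuit

open BitGadget

variable {k : Type u} [CommRing k] {τ : Type v} [DecidableEq τ] {L : ℕ}

/-! ### Change of coefficients keeps sign constants; `HasTauDeg` witnesses over any ring -/

omit [DecidableEq τ] in
/-- Sign constants are preserved by ring maps. [cite: Burgisser2000, §4.1] -/
private theorem isSignConstant_map {k' : Type*} [CommRing k'] (φ : k' →+* k) {c : k'}
    (h : ArithCircuit.IsSignConstant c) : ArithCircuit.IsSignConstant (φ c) := by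
  rcases h with h | h | h
  · exact Or.inl (by rw [h, map_zero])
  · exact Or.inr (Or.inl (by rw [h, map_one]))
  · exact Or.inr (Or.inr (by rw [← map_one φ, ← map_add, h, map_zero]))

omit [DecidableEq τ] in
/-- Mapped operands keep sign constants. [cite: Burgisser2000, §4.1] -/
private theorem operand_hasSignConstants_map {k' : Type*} [CommRing k'] (φ : k' →+* k)
    {u : ArithCircuit.Operand k' τ} (h : u.HasSignConstants) : (u.map φ).HasSignConstants := by
  cases u with
  | var i => trivial
  | const c => exact isSignConstant_map φ h
  | gate j => trivial

omit [DecidableEq τ] in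
/-- **A constant-free circuit over `ℤ` is a constant-free circuit over `k`.** [cite: Burgisser2000, §4.1] -/
private theorem hasSignConstants_map {k' : Type*} [CommRing k'] (φ : k' →+* k)
    {P : ArithCircuit k' τ} (h : P.HasSignConstants) : (P.map φ).HasSignConstants := by
  refine ⟨fun g hg => ?_, operand_hasSignConstants_map φ h.2⟩
  simp only [ArithCircuit.map, List.mem_map] at hg
  obtain ⟨g', hg', rfl⟩ := hg
  have hg'' := h.1 g' hg'
  cases g' with
  | sum args =>
    intro a ha
    simp only [List.mem_map] at ha
    obtain ⟨a', ha', rfl⟩ := ha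
    exact ⟨isSignConstant_map φ (hg'' a' ha').1, operand_hasSignConstants_map φ (hg'' a' ha').2⟩
  | prod args =>
    intro u hu
    simp only [List.mem_map] at hu
    obtain ⟨u', hu', rfl⟩ := hu
    exact operand_hasSignConstants_map φ (hg'' u' hu')

omit [DecidableEq τ] in
/-- A `HasTauDeg` witness over `ℤ` gives a fan-in-two constant-free circuit over `k` computing the
image polynomial. [cite: Burgisser2000, §4.1] -/
private theorem exists_circuit_of_hasTauDeg {f : MvPolynomial τ ℤ} {s d : ℕ} (h : HasTauDeg f s d) :
    ∃ P : ArithCircuit k τ, P.IsFanInTwo ∧ P.HasSignConstants ∧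
      P.eval = MvPolynomial.map (Int.castRingHom k) f ∧ P.size ≤ s := by
  obtain ⟨P, h1, h2, h3, h4, -⟩ := h
  exact ⟨P.map (Int.castRingHom k), h1.map _, hasSignConstants_map _ h2,
    by rw [ArithCircuit.eval_map_apply, h3], by rw [ArithCircuit.size_map]; exact h4⟩

/-! ### The template is natural under ring maps fixing the label variables -/

variable (U V : Fin (3 * L) → τ)

omit [DecidableEq τ] in
/-- Ring maps fixing the label variables commute with the template.
[cite: ChatterjeeTengse2023, Claim 37 (v1; p0012.txt:L49–L67)] -/
theorem map_mvEdgeT {R : Type*} [CommRing R] [DecidableEq τ]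
    (f : MvPolynomial τ R →+* MvPolynomial τ k)
    (hU : ∀ l, f (X (U l)) = X (U l)) (hV : ∀ l, f (X (V l)) = X (V l)) (m₁ m₂ : MvPolynomial τ R) :
    f (mvEdgeT U V m₁ m₂) = mvEdgeT U V (f m₁) (f m₂) := by
  have eU : ∀ s, (⇑f ∘ Xp (k := R) s U) = Xp (k := k) s U := fun s => funext fun i => hU _
  have eV : ∀ s, (⇑f ∘ Xp (k := R) s V) = Xp (k := k) s V := fun s => funext fun i => hV _
  have fbit : ∀ b : Bool, f (bit (k := R) b) = (bit b : MvPolynomial τ k) := fun b => by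
    cases b <;> simp [bit]
  have eK : ∀ b : Fin L → Bool, (⇑f ∘ kbits (k := R) b) = kbits (k := k) b := fun b =>
    funext fun i => fbit (b i)
  have eI : (⇑f ∘ INC L (Xp (k := R) 0 U)) = INC L (Xp (k := k) 0 U) := funext fun i => by
    rw [Function.comp_apply, map_INC, eU]
  simp only [mvEdgeT, isSnkP, isSrcP, isSuccP, isLastP, transT, selP, map_add, map_sub, map_mul,
    map_one, map_EQ, map_LT, eU, eV, eK, eI]

/-! ### The template has a small constant-free circuit -/

omit [DecidableEq τ] in
/-- **The gadget part is `O(L²)`**: the template at two variables `m₁ = X μ₁`, `m₂ = X μ₂` has a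
constant-free fan-in-two circuit over `ℤ` of size `≤ 112·L² + 253·L + 49` ("`Ĉ` has size
`O(size(C) + log² N)`"). [cite: ChatterjeeTengse2023, Claim 37 (v1; p0012.txt:L66–L67)] -/
theorem hasTauDeg_mvEdgeT (μ₁ μ₂ : τ) :
    ∃ D, HasTauDeg (mvEdgeT U V (X μ₁) (X μ₂) : MvPolynomial τ ℤ) (112 * L ^ 2 + 253 * L + 49) D := by
  have hxU : ∀ (s : Fin 3) (i : Fin L), HasTauDeg (Xp (k := ℤ) s U i) 0 1 := fun s i => HasTauDeg.X _
  have hxV : ∀ (s : Fin 3) (i : Fin L), HasTauDeg (Xp (k := ℤ) s V i) 0 1 := fun s i => HasTauDeg.X _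
  have hK : ∀ (b : Fin L → Bool) (i : Fin L), HasTauDeg (kbits (k := ℤ) (τ := τ) b i) 0 1 :=
    fun b i => hasTauDeg_bitVal (b i)
  -- `EQ`/`LT` on plain inputs (types inferred: the size/degree expressions of the gadget lemmas)
  have eUK := fun (s : Fin 3) (b : Fin L → Bool) =>
    hasTauDeg_EQ L (a := Xp (k := ℤ) s U) (b := kbits b) (hxU s) (hK b)
  have eVK := fun (s : Fin 3) (b : Fin L → Bool) =>
    hasTauDeg_EQ L (a := Xp (k := ℤ) s V) (b := kbits b) (hxV s) (hK b)
  have eVU := fun s s' : Fin 3 => hasTauDeg_EQ L (a := Xp (k := ℤ) s V) (b := Xp s' U) (hxV s) (hxU s')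
  have eUU := fun s s' : Fin 3 => hasTauDeg_EQ L (a := Xp (k := ℤ) s U) (b := Xp s' U) (hxU s) (hxU s')
  have eVV := fun s s' : Fin 3 => hasTauDeg_EQ L (a := Xp (k := ℤ) s V) (b := Xp s' V) (hxV s) (hxV s')
  have lUU := fun s s' : Fin 3 => hasTauDeg_LT L (a := Xp (k := ℤ) s U) (b := Xp s' U) (hxU s) (hxU s')
  have lVV := fun s s' : Fin 3 => hasTauDeg_LT L (a := Xp (k := ℤ) s V) (b := Xp s' V) (hxV s) (hxV s')
  have lUV := fun s s' : Fin 3 => hasTauDeg_LT L (a := Xp (k := ℤ) s U) (b := Xp s' V) (hxU s) (hxV s')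
  -- `INC` and the two `EQ`s fed by it (inputs lifted to the common bound `(5L, L+1)`)
  have hI : ∀ i, HasTauDeg (INC L (Xp (k := ℤ) 0 U) i) (5 * L) (L + 1) := fun i =>
    (hasTauDeg_INC L (s₀ := 0) (d₀ := 1) (hxU 0) i).mono (by omega) (by simp)
  have hxV' : ∀ i, HasTauDeg (Xp (k := ℤ) 0 V i) (5 * L) (L + 1) := fun i =>
    (hxV 0 i).mono (by omega) (by omega)
  have hK' : ∀ (b : Fin L → Bool) (i : Fin L), HasTauDeg (kbits (k := ℤ) (τ := τ) b i) (5 * L) (L + 1) :=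
    fun b i => (hK b i).mono (by omega) (by omega)
  have eVI := hasTauDeg_EQ L (a := Xp (k := ℤ) 0 V) (b := INC L (Xp 0 U)) hxV' hI
  have eIK := fun b : Fin L → Bool => hasTauDeg_EQ L (a := INC L (Xp (k := ℤ) 0 U)) (b := kbits b) hI (hK' b)
  -- the pieces
  have snkU : HasTauDeg (isSnkP (k := ℤ) U) _ _ := ((eUK 0 _).mul (eUK 1 _)).mul (eUK 2 _)
  have snkV : HasTauDeg (isSnkP (k := ℤ) V) _ _ := ((eVK 0 _).mul (eVK 1 _)).mul (eVK 2 _)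
  have srcU : HasTauDeg (isSrcP (k := ℤ) U) _ _ := ((eUK 0 _).mul (eUK 1 _)).mul (eUK 2 _)
  have sel : HasTauDeg (selP (k := ℤ) V) _ _ := (lVV 2 1).sub (eVV 2 1)
  have tr : HasTauDeg (transT (k := ℤ) U V (X μ₁) (X μ₂)) _ _ :=
    ((((lUU 2 1).mul (eVU 1 1)).mul sel).mul (HasTauDeg.X μ₁)).add
      ((((eUU 2 1).mul (lUV 1 1)).mul sel).mul (HasTauDeg.X μ₂))
  have succ : HasTauDeg (isSuccP (k := ℤ) U V) _ _ := (eVI.mul (eVK 0 _).one_sub).mul (eVK 0 _).one_sub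
  have last : HasTauDeg (isLastP (k := ℤ) U) _ _ := eIK _
  have h : HasTauDeg (mvEdgeT U V (X μ₁) (X μ₂) : MvPolynomial τ ℤ) _ _ :=
    (((snkU.mul snkV).add (((srcU.mul (eVK 0 _)).mul sel).mul (HasTauDeg.X μ₂))).sub
      (succ.mul tr)).add ((last.mul snkV).mul tr)
  refine ⟨_, h.mono ?_ le_rfl⟩
  ring_nf
  omega

/-! ### Renamed copies of the encoder's circuit -/

variable (r c : Fin L → τ)

/-- Operands renaming the blocks `r ↦ ρr`, `c ↦ ρc` (variables for variables).
[cite: ChatterjeeTengse2023, Claim 37 "C(x, j_u, j_v)" (v1; p0012.txt:L53–L57)] -/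
def copyOps (ρr ρc : Fin L → τ) : τ → ArithCircuit.Operand k τ :=
  onBlock r (fun i => .var (ρr i)) (onBlock c (fun i => .var (ρc i)) .var)

/-- The renaming substitution as polynomials. [cite: ChatterjeeTengse2023, Claim 37 (v1; p0012.txt:L53–L57)] -/
abbrev copySubst (ρr ρc : Fin L → τ) : τ → MvPolynomial τ k :=
  onBlock r (fun i => X (ρr i)) (onBlock c (fun i => X (ρc i)) X)

variable {r c}

/-- The operands read the renaming. [cite: ChatterjeeTengse2023, Claim 37 (v1; p0012.txt:L53–L57)] -/
theorem copyOps_eval (ρr ρc : Fin L → τ) (v : τ) (ws : List (MvPolynomial τ k)) :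
    (copyOps (k := k) r c ρr ρc v).eval ws = copySubst (k := k) r c ρr ρc v := by
  unfold copyOps copySubst onBlock
  split_ifs <;> rfl

/-- All renaming operands are variables (sign constants trivially).
[cite: ChatterjeeTengse2023, Claim 37 (v1; p0012.txt:L53–L57)] -/
theorem copyOps_hasSignConstants (ρr ρc : Fin L → τ) (v : τ) :
    (copyOps (k := k) r c ρr ρc v).HasSignConstants := by
  unfold copyOps onBlock
  split_ifs <;> trivial

/-- The renaming commutes with the projections of a circuit that projects none of `r, c, ρr, ρc`.
[cite: ChatterjeeTengse2023, Claim 38 (v1; p0013.txt:L9–L25)] -/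
theorem substCompat_copySubst (F_r : Function.Injective r) (F_c : Function.Injective c)
    {ρr ρc : Fin L → τ} {C : ProjCircuit k τ}
    (hC : ∀ i ∈ C.projVars, (∀ l, r l ≠ i) ∧ (∀ l, c l ≠ i) ∧ (∀ l, ρr l ≠ i) ∧ ∀ l, ρc l ≠ i) :
    C.SubstCompat id (copySubst (k := k) r c ρr ρc) := by
  refine ProjCircuit.substCompat_of_vars C (fun i hi => ?_) (fun i hi i' hi' => ?_)
  · obtain ⟨h1, h2, -, -⟩ := hC i hi
    rw [copySubst, onBlock_of_ne h1, onBlock_of_ne h2]; rfl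
  · obtain ⟨-, -, h3, h4⟩ := hC i hi
    change i ∉ (onBlock r (fun j => (X (ρr j) : MvPolynomial τ k)) (onBlock c (fun j => X (ρc j)) X) i').vars
    by_cases ha : ∃ l, r l = i'
    · obtain ⟨l, rfl⟩ := ha
      rw [onBlock_blk F_r]; exact notMem_vars_X (h3 l)
    · rw [onBlock_of_ne (fun l h => ha ⟨l, h⟩)]
      by_cases hb : ∃ l, c l = i'
      · obtain ⟨l, rfl⟩ := hb
        rw [onBlock_blk F_c]; exact notMem_vars_X (h4 l)
      · rw [onBlock_of_ne (fun l h => hb ⟨l, h⟩)]; exact notMem_vars_X hi'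

/-- The value list of a substitution circuit: prefix values, then the substituted values (the
list form of `ProjCircuit.eval_subst`). [cite: ChatterjeeTengse2023, Claim 38 (v1; p0013.txt:L9–L25)] -/
theorem gateValues_subst (P : ProjCircuit k τ) (pre : List (ProjCircuit.Gate k τ)) {e : τ → τ}
    {ρ : τ → ArithCircuit.Operand k τ} {h : τ → MvPolynomial τ k}
    (hρ : ∀ i ws, (ρ i).eval (ProjCircuit.gateValues pre ++ ws) = h i) (hcompat : P.SubstCompat e h) :
    ProjCircuit.gateValues (P.subst pre e ρ).gates =
      ProjCircuit.gateValues pre ++ (ProjCircuit.gateValues P.gates).map (aeval h) := by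
  have hlen : pre.length = (ProjCircuit.gateValues pre).length :=
    (ProjCircuit.gateValues_length (k := k) pre).symm
  have hgs : ∀ g ∈ P.gates, ∀ i b u, g = ProjCircuit.Gate.proj i b u →
      ∀ (c : k) (v : MvPolynomial τ k), aeval h (projVar i c v) = projVar (e i) c (aeval h v) := by
    rintro g hg i b u rfl c v
    exact hcompat i ⟨b, u, hg⟩ c v
  unfold ProjCircuit.gateValues
  rw [ProjCircuit.subst, List.foldl_append, hlen]
  have := ProjCircuit.foldl_subst (k := k) hρ P.gates hgs []
  simpa [ProjCircuit.gateValues] using this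

omit [CommRing k] [DecidableEq τ] in
/-- Projected variables of a substitution circuit: those of the prefix and those of `P`.
[cite: ChatterjeeTengse2023, Claim 38 (v1; p0013.txt:L18–L21)] -/
theorem projVars_subst_subset [DecidableEq τ] (P : ProjCircuit k τ) (pre : List (ProjCircuit.Gate k τ))
    (ρ : τ → ArithCircuit.Operand k τ) :
    (P.subst pre id ρ).projVars ⊆ {i | ∃ b u, ProjCircuit.Gate.proj i b u ∈ pre} ∪ P.projVars := by
  rintro i ⟨b, u, hg⟩
  simp only [ProjCircuit.subst, List.mem_append, List.mem_map] at hg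
  rcases hg with hg | ⟨g', hg', hge⟩
  · exact Or.inl ⟨b, u, hg⟩
  · right
    cases g' with
    | arith g => simp [ProjCircuit.Gate.subst] at hge
    | proj i' b' u' =>
      simp only [ProjCircuit.Gate.subst, ProjCircuit.Gate.proj.injEq, id_eq] at hge
      obtain ⟨rfl, -, -⟩ := hge
      exact ⟨b', u', hg'⟩

omit [CommRing k] [DecidableEq τ] in
/-- An ordinary circuit projects nothing. [cite: ChatterjeeTengse2023, Def. 2.20 (v1: Def. 28)] -/
theorem projVars_ofArithCircuit [DecidableEq τ] (T : ArithCircuit k τ) :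
    (ProjCircuit.ofArithCircuit T).projVars = ∅ := by
  ext i
  simp only [ProjCircuit.projVars, ProjCircuit.ofArithCircuit, List.mem_map, Set.mem_setOf_eq,
    Set.mem_empty_iff_false, iff_false, not_exists, not_and]
  rintro b u g - h
  cases h

/-! ### The circuit: copy `C(x, u_u, u_v)`, copy `C(x, t_v, u_v)`, then the template -/

variable (r c)

/-- First copy `C(x, u_u, u_v)`. [cite: ChatterjeeTengse2023, Claim 37 (v1; p0012.txt:L53–L57)] -/
def copy1 (C : ProjCircuit k τ) : ProjCircuit k τ :=
  C.subst [] id (copyOps (k := k) r c (part 2 U) (part 2 V))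

/-- Second copy `C(x, t_v, u_v)`, placed after the first. [cite: ChatterjeeTengse2023, Claim 37 (v1; p0012.txt:L53–L57)] -/
def copy2 (C : ProjCircuit k τ) : ProjCircuit k τ :=
  C.subst (copy1 U V r c C).gates id (copyOps (k := k) r c (part 1 V) (part 2 V))

/-- The operands feeding the two copies' outputs into the template's variables `μ₁, μ₂`.
[cite: ChatterjeeTengse2023, Claim 37 (v1; p0012.txt:L53–L67)] -/
def tmplOps (μ₁ μ₂ : τ) (C : ProjCircuit k τ) : τ → ArithCircuit.Operand k τ := fun v =>
  if v = μ₁ then (copy1 U V r c C).output.truncate (copy1 U V r c C).size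
  else if v = μ₂ then (copy2 U V r c C).output.truncate (copy2 U V r c C).size
  else .var v

/-- **The circuit `Ĉ`**: the two copies followed by the template circuit `T` reading their outputs.
[cite: ChatterjeeTengse2023, Claim 37 (v1; p0012.txt:L53–L67)] -/
def mvCircuit (μ₁ μ₂ : τ) (C : ProjCircuit k τ) (T : ArithCircuit k τ) : ProjCircuit k τ :=
  (ProjCircuit.ofArithCircuit T).subst (copy2 U V r c C).gates id (tmplOps U V r c μ₁ μ₂ C)

variable {r c U V} {E : MvPolynomial τ k}

/-- Semantics and value list of the first copy. [cite: ChatterjeeTengse2023, Claim 37 (v1; p0012.txt:L53–L57)] -/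
theorem eval_copy1 (F : MVFresh r c U V) {C : ProjCircuit k τ} (hCE : C.Computes E)
    (hC : ∀ i ∈ C.projVars, (∀ l, r l ≠ i) ∧ (∀ l, c l ≠ i) ∧ (∀ l, U l ≠ i) ∧ ∀ l, V l ≠ i) :
    (copy1 U V r c C).eval = copyPoly r c E (part 2 U) (part 2 V) := by
  rw [copy1, ProjCircuit.eval_subst C [] (fun i _ => copyOps_eval (part 2 U) (part 2 V) i _)
    (substCompat_copySubst (ρr := part 2 U) (ρc := part 2 V) F.r_inj F.c_inj fun i hi =>
      ⟨(hC i hi).1, (hC i hi).2.1, fun _ => (hC i hi).2.2.1 _, fun _ => (hC i hi).2.2.2 _⟩),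
    show C.eval = E from hCE]
  rfl

/-- Semantics of the second copy. [cite: ChatterjeeTengse2023, Claim 37 (v1; p0012.txt:L53–L57)] -/
theorem eval_copy2 (F : MVFresh r c U V) {C : ProjCircuit k τ} (hCE : C.Computes E)
    (hC : ∀ i ∈ C.projVars, (∀ l, r l ≠ i) ∧ (∀ l, c l ≠ i) ∧ (∀ l, U l ≠ i) ∧ ∀ l, V l ≠ i) :
    (copy2 U V r c C).eval = copyPoly r c E (part 1 V) (part 2 V) := by
  rw [copy2, ProjCircuit.eval_subst C _ (fun i _ => copyOps_eval (part 1 V) (part 2 V) i _)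
    (substCompat_copySubst (ρr := part 1 V) (ρc := part 2 V) F.r_inj F.c_inj fun i hi =>
      ⟨(hC i hi).1, (hC i hi).2.1, fun _ => (hC i hi).2.2.2 _, fun _ => (hC i hi).2.2.2 _⟩),
    show C.eval = E from hCE]
  rfl

/-- The value list of the second copy extends that of the first.
[cite: ChatterjeeTengse2023, Claim 37 (v1; p0012.txt:L53–L57)] -/
theorem gateValues_copy2 (F : MVFresh r c U V) {C : ProjCircuit k τ}
    (hC : ∀ i ∈ C.projVars, (∀ l, r l ≠ i) ∧ (∀ l, c l ≠ i) ∧ (∀ l, U l ≠ i) ∧ ∀ l, V l ≠ i) :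
    ∃ rest, ProjCircuit.gateValues (copy2 U V r c C).gates =
      ProjCircuit.gateValues (copy1 U V r c C).gates ++ rest :=
  ⟨_, gateValues_subst C _ (fun i _ => copyOps_eval (part 1 V) (part 2 V) i _)
    (substCompat_copySubst (ρr := part 1 V) (ρc := part 2 V) F.r_inj F.c_inj fun i hi =>
      ⟨(hC i hi).1, (hC i hi).2.1, fun _ => (hC i hi).2.2.2 _, fun _ => (hC i hi).2.2.2 _⟩)⟩

/-- **Claim 37's circuit, for an encoder with ARBITRARY constants (the printed general case):
the encoder `Ĉ` of the program's adjacency matrix has a fan-in-two circuit with projection gates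
of size `≤ 2·size(C) + (112·L² + 253·L + 49)`** ("`Ĉ` has size `O(size(C) + log² N)`"; here
TWO uses of `C` instead of the printed three), computing `mvEdge`, projecting only what `C`
projects, **and — the printed "moreover" — constant-free (sign constants) whenever `C` is**
("… and is a constant-free algebraic circuit (without projection gates) if `C` is constant
free"): the construction copies `C`'s gates (its constants pass through unchanged) and adds only
the gadget template, whose constants are `0, ±1`. The two scratch variables `μ₁ ≠ μ₂` (outside
the label blocks) only name the splice points of the two copies. The program is the tree's signed
Mahajan–Vinay clow program (`GKKP2011.T₀`, `IL17.fullN`; [MahajanVinay1997, Thm. 1] =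
[MahajanVinay1999, Thm. 3.2], held text `paper:doi-10-1137-s0895480198338827` p0005.txt:L20).
ERRATUM (val-lit t24 g10, referee rows np 1357 / 1370): the first accepted text stated only the
constant-free case (`exists_projCircuit_mvEdge`, now a corollary of this theorem), i.e. it took
`C.HasSignConstants` as a hypothesis where the source has an implication; corrected here, no
construction changed.
[cite: ChatterjeeTengse2023, Claim 2.30 (v1: Claim 37; p0012.txt:L30–L31, L66–L67)] -/
theorem exists_projCircuit_mvEdge_general (F : MVFresh r c U V) {μ₁ μ₂ : τ} (hμ : μ₁ ≠ μ₂)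
    (hμU : ∀ l, U l ≠ μ₁ ∧ U l ≠ μ₂) (hμV : ∀ l, V l ≠ μ₁ ∧ V l ≠ μ₂)
    {C : ProjCircuit k τ} (h2 : C.IsFanInTwo) (hCE : C.Computes E)
    (hC : ∀ i ∈ C.projVars, (∀ l, r l ≠ i) ∧ (∀ l, c l ≠ i) ∧ (∀ l, U l ≠ i) ∧ ∀ l, V l ≠ i) :
    ∃ Q : ProjCircuit k τ, Q.IsFanInTwo ∧ (C.HasSignConstants → Q.HasSignConstants) ∧
      Q.Computes (mvEdge r c E U V) ∧
      Q.size ≤ 2 * C.size + (112 * L ^ 2 + 253 * L + 49) ∧ Q.projVars ⊆ C.projVars := by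
  -- the template circuit over `k`
  obtain ⟨D, hT⟩ := hasTauDeg_mvEdgeT U V μ₁ μ₂
  obtain ⟨T, hT2, hTsc, hTev, hTsz⟩ := exists_circuit_of_hasTauDeg (k := k) hT
  have hTev' : T.eval = mvEdgeT U V (X μ₁) (X μ₂) := by
    rw [hTev]
    have := map_mvEdgeT U V (k := k) (MvPolynomial.map (Int.castRingHom k))
      (fun l => MvPolynomial.map_X _ _) (fun l => MvPolynomial.map_X _ _) (X μ₁) (X μ₂)
    rw [this, MvPolynomial.map_X, MvPolynomial.map_X]
  -- the copies
  set P₁ := copy1 U V r c C with hP₁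
  set P₂ := copy2 U V r c C with hP₂
  have hP₁2 : P₁.IsFanInTwo := ProjCircuit.isFanInTwo_subst h2 (by simp) _ _
  have hP₂2 : P₂.IsFanInTwo := ProjCircuit.isFanInTwo_subst h2 hP₁2 _ _
  -- sign constants of the copies, WHEN `C` has them (its constants are copied verbatim)
  have hP₁sc : C.HasSignConstants → P₁.HasSignConstants := fun hsc =>
    ProjCircuit.hasSignConstants_subst hsc (by simp) _ (copyOps_hasSignConstants _ _)
  have hP₂sc : C.HasSignConstants → P₂.HasSignConstants := fun hsc =>
    ProjCircuit.hasSignConstants_subst hsc (hP₁sc hsc).1 _ (copyOps_hasSignConstants _ _)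
  have hP₁ev : P₁.eval = copyPoly r c E (part 2 U) (part 2 V) := eval_copy1 F hCE hC
  have hP₂ev : P₂.eval = copyPoly r c E (part 1 V) (part 2 V) := eval_copy2 F hCE hC
  obtain ⟨rest, hgv⟩ := gateValues_copy2 (k := k) F (C := C) hC
  -- the splice
  let hT' : τ → MvPolynomial τ k := fun v =>
    if v = μ₁ then P₁.eval else if v = μ₂ then P₂.eval else X v
  have hρ : ∀ v ws, (tmplOps U V r c μ₁ μ₂ C v).eval (ProjCircuit.gateValues P₂.gates ++ ws) = hT' v := by
    intro v ws
    simp only [tmplOps, hT']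
    by_cases h1 : v = μ₁
    · simp only [h1, if_true, ← hP₁]
      rw [hgv, List.append_assoc, ProjCircuit.size, ← ProjCircuit.gateValues_length (k := k) P₁.gates,
        ArithCircuit.Operand.eval_truncate_append]
      rfl
    · by_cases h2' : v = μ₂
      · simp only [h2', hμ.symm, if_false, if_true, ← hP₂]
        rw [ProjCircuit.size, ← ProjCircuit.gateValues_length (k := k) P₂.gates,
          ArithCircuit.Operand.eval_truncate_append]
        rfl
      · simp only [h1, h2', if_false]
        rfl
  have hcompat : (ProjCircuit.ofArithCircuit T).SubstCompat id hT' := fun i hi => by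
    rw [projVars_ofArithCircuit] at hi
    exact absurd hi (Set.notMem_empty i)
  refine ⟨mvCircuit U V r c μ₁ μ₂ C T, ?_, ?_, ?_, ?_, ?_⟩
  · -- fan-in two
    exact ProjCircuit.isFanInTwo_subst (ProjCircuit.isFanInTwo_ofArithCircuit hT2) hP₂2 _ _
  · -- sign constants (the printed "moreover"): the template's constants are `0, ±1`
    intro hsc
    refine ProjCircuit.hasSignConstants_subst (ProjCircuit.hasSignConstants_ofArithCircuit hTsc)
      (hP₂sc hsc).1 _ (fun v => ?_)
    simp only [tmplOps]
    split_ifs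
    · exact (hP₁sc hsc).2.truncate _
    · exact (hP₂sc hsc).2.truncate _
    · trivial
  · -- semantics
    change (mvCircuit U V r c μ₁ μ₂ C T).eval = mvEdge r c E U V
    rw [mvCircuit, ← hP₂, ProjCircuit.eval_subst _ _ hρ hcompat, ProjCircuit.eval_ofArithCircuit, hTev']
    have hfix := map_mvEdgeT U V (k := k) ((aeval hT').toRingHom : MvPolynomial τ k →+* MvPolynomial τ k)
      (fun l => by
        change aeval hT' (X (U l)) = X (U l)
        rw [aeval_X]; simp only [hT', (hμU l).1, (hμU l).2, if_false])
      (fun l => by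
        change aeval hT' (X (V l)) = X (V l)
        rw [aeval_X]; simp only [hT', (hμV l).1, (hμV l).2, if_false])
      (X μ₁) (X μ₂)
    change aeval hT' (mvEdgeT U V (X μ₁) (X μ₂)) = _
    change ((aeval hT').toRingHom : MvPolynomial τ k →+* MvPolynomial τ k) _ = _ at hfix ⊢
    rw [hfix]
    change mvEdgeT U V (aeval hT' (X μ₁)) (aeval hT' (X μ₂)) = _
    rw [aeval_X, aeval_X]
    simp only [hT', if_true, hμ.symm, if_false, hP₁ev, hP₂ev, mvEdge]
  · -- size
    rw [mvCircuit, ProjCircuit.size_subst, ProjCircuit.size_ofArithCircuit, ← hP₂,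
      show P₂.gates.length = P₂.size from rfl, hP₂, copy2, ProjCircuit.size_subst, ← hP₁,
      show P₁.gates.length = P₁.size from rfl, hP₁, copy1, ProjCircuit.size_subst, List.length_nil]
    omega
  · -- projected variables
    intro i hi
    rcases projVars_subst_subset _ _ _ hi with ⟨b, u, hg⟩ | hi
    · -- a projection gate among the second copy's gates
      rcases projVars_subst_subset C _ _ ⟨b, u, hg⟩ with ⟨b', u', hg'⟩ | hi'
      · rcases projVars_subst_subset C [] _ ⟨b', u', hg'⟩ with ⟨_, _, h⟩ | hi''
        · simp at h
        · exact hi''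
      · exact hi'
    · rw [projVars_ofArithCircuit] at hi
      exact absurd hi (Set.notMem_empty i)

/-- **Claim 37's circuit, constant-free case** (the first accepted statement, kept verbatim;
now the specialisation of `exists_projCircuit_mvEdge_general` to a constant-free encoder `C`):
a constant-free fan-in-two circuit with projection gates of size
`≤ 2·size(C) + (112·L² + 253·L + 49)` computing `mvEdge`, projecting only what `C` projects.
[cite: ChatterjeeTengse2023, Claim 2.30 (v1: Claim 37; p0012.txt:L30–L31, L66–L67)] -/
theorem exists_projCircuit_mvEdge (F : MVFresh r c U V) {μ₁ μ₂ : τ} (hμ : μ₁ ≠ μ₂)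
    (hμU : ∀ l, U l ≠ μ₁ ∧ U l ≠ μ₂) (hμV : ∀ l, V l ≠ μ₁ ∧ V l ≠ μ₂)
    {C : ProjCircuit k τ} (h2 : C.IsFanInTwo) (hsc : C.HasSignConstants) (hCE : C.Computes E)
    (hC : ∀ i ∈ C.projVars, (∀ l, r l ≠ i) ∧ (∀ l, c l ≠ i) ∧ (∀ l, U l ≠ i) ∧ ∀ l, V l ≠ i) :
    ∃ Q : ProjCircuit k τ, Q.IsFanInTwo ∧ Q.HasSignConstants ∧ Q.Computes (mvEdge r c E U V) ∧
      Q.size ≤ 2 * C.size + (112 * L ^ 2 + 253 * L + 49) ∧ Q.projVars ⊆ C.projVars := by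
  obtain ⟨Q, hQ2, hQsc, hQE, hQsz, hQproj⟩ := exists_projCircuit_mvEdge_general F hμ hμU hμV h2 hCE hC
  exact ⟨Q, hQ2, hQsc hsc, hQE, hQsz, hQproj⟩

end Circuit

end Literature.Barriers.ValiantsHypothesis
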